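import Literature.MathematicalPhysics.KineticTheory.TaggedSphereFourierFibre
import Literature.MathematicalPhysics.KineticTheory.TaggedSphereModeEnergy
import Mathlib.Analysis.InnerProductSpace.Calculus
import Mathlib.Analysis.ODE.Gronwall
import HarnessLib

/-!
# The energy estimate for the Fourier fibres of the tagged linear Boltzmann equation
(Bodineau–Gallagher–Saint-Raymond, Invent. Math. 203 (2016) = arXiv:1305.3397v2, §6.1.2–6.1.3,
the Hilbert expansion (6.4)–(6.6) and the convergence proof, recast as an `L²(M_β dv)` energy
estimate fibre by fibre; a layer of the proof of the hydrodynamic limit (6.3),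
`Literature.MathematicalPhysics.KineticTheory.bgsr_hydrodynamicLimit` of `TaggedSphereDiffusion`)

For the `k`-th spatial Fourier coefficient `ψ_k(t, v)` of the solution of (1.3) with datum `ρ⁰`
(`kineticFibre`, `TaggedSphereFourierFibre`), which solves `∂ₜ ψ = -iθ_k ψ - α L ψ`,
`θ_k(v) = 2π k·v`, we compare `ψ_k` with the *first-order Hilbert expansion*
`Ψ(t, v) = ρ̂⁰(k) e^{-λt/α} (1 - i α⁻¹ p(v))`, `p(v) = 2π k·b(v)` (`correctorPhase`, `b` the
corrector (6.5): `L p = θ_k`), `λ = 4π² κ_β |k|²` (`heatRate`, `κ_β` the coefficient (6.8)), i.e.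
BGSR's `ρ + α⁻¹ ρ₁` with `ρ₁ = -b·∇ₓ ρ` for the heat flow `ρ̂(k, τ) = ρ̂⁰(k) e^{-λτ}`, `t = ατ`.
The remainder `R = Ψ - ψ_k` satisfies `∂ₜ R = -iθ_k R - α L R + S` with a source
`S = ρ̂⁰(k) e^{-λt/α} α⁻¹ (S₀ + α⁻¹ S₁)`, `S₀ = θ_k p - λ` of `M_β`-mean zero by the isotropy
`∫ (k·v)(k·b) M_β = κ_β |k|²` (`TaggedSphereSpectralGap`). The energy identity
`d/dt ∫ |R|² M_β = -2α ⟨L R, R⟩ + 2 Re ∫ S R̄ M_β`, the spectral gap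
`⟨L g, g⟩ ≥ c₀ ‖g - ⟨g⟩‖²_{L²(a_β M_β)}` (`exists_spectralGap`) and Young's inequality give
`y' ≤ A + B y` for `y(t) = ∫ |R(t)|² M_β` with `A = O(α⁻²)`, `B = O(α⁻²)`, `y(0) = O(α⁻²)`, whence by
Grönwall `sup_{t ≤ αT} ‖ψ_k(t) - ρ̂⁰(k) e^{-λt/α}‖_{L²(M_β)} = O(α^{-1/2})`
(`kineticFibre_energy_estimate`). The degenerate cases are exact: `ψ_k ≡ 0` when `ρ̂⁰(k) = 0`
(`seriesFibre_eq_zero_of_datumCoeff_eq_zero`) and `ψ_0 ≡ ρ̂⁰(0)` (`seriesFibre_zero_mode`).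
The Grönwall bookkeeping reuses `IsModePair.gronwallBound_le_mul_exp` of `TaggedSphereModeEnergy`
(the parallel real-variable energy layer for the velocity profile of a mode).

This replaces the `M_β`-weighted maximum principle displayed in BGSR §6.1.3, which does not hold
with a constant uniform in `α`; the statement (6.3) is unaffected.

## References

* T. Bodineau, I. Gallagher, L. Saint-Raymond, *The Brownian motion as the limit of a
  deterministic system of hard-spheres*, Invent. Math. 203 (2016) 493–553 = arXiv:1305.3397v2,
  §6.1.2 (6.4)–(6.8), §6.1.3.
* A. Bensoussan, J.-L. Lions, G. Papanicolaou, *Boundary layers and homogenization of transport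
  processes*, Publ. RIMS 15 (1979) (BGSR's [6]), §3 (the energy method for the diffusion
  approximation of linear transport).
-/

noncomputable section

open MeasureTheory Metric Set Filter Topology ProbabilityTheory Complex
open scoped InnerProductSpace ENNReal NNReal Real

/-- As in `TaggedSphereFourierFibre`: the measure on `ℝ/ℤ` is the Haar probability measure.
[folklore] -/
local instance fibreEnergyMeasureSpace : MeasureSpace UnitAddCircle := ⟨AddCircle.haarAddCircle⟩

/-- The measure on `ℝ/ℤ` is a Haar measure. [folklore] -/
local instance fibreEnergyIsAddHaarMeasure : Measure.IsAddHaarMeasure (volume : Measure UnitAddCircle) :=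
  inferInstanceAs (Measure.IsAddHaarMeasure AddCircle.haarAddCircle)

/-- The measure on `ℝ/ℤ` is a probability measure. [folklore] -/
local instance fibreEnergyIsProbabilityMeasure : IsProbabilityMeasure (volume : Measure UnitAddCircle) :=
  inferInstanceAs (IsProbabilityMeasure AddCircle.haarAddCircle)

namespace Literature.MathematicalPhysics.KineticTheory

open Literature.Analysis.FunctionSpaces (maxwellianBeta maxwellianBeta_pos)
open TaggedSphereDiffusion (collisionFrequency)
open UnitAddTorus

variable {d : Type*} [Fintype d] {β α : ℝ}

local notation "𝔼" => EuclideanSpace ℝ d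
local notation "𝕋" => UnitAddTorus d

/-! ## The wave vector, the phase and the corrector phase -/

/-- The wave vector `k ∈ ℤ^d` as an element of `ℝ^d`. [folklore] -/
def kVec (k : d → ℤ) : 𝔼 := WithLp.toLp 2 fun i => (k i : ℝ)

omit [Fintype d] in
/-- Coordinates of the wave vector. [folklore] -/
@[simp]
theorem kVec_apply (k : d → ℤ) (i : d) : kVec k i = (k i : ℝ) := rfl

omit [Fintype d] in
/-- `kVec 0 = 0`. [folklore] -/
@[simp]
theorem kVec_zero : kVec (0 : d → ℤ) = 0 := by
  ext i; simp [kVec]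

/-- The phase is `2π k·v`. [folklore] -/
theorem fourierPhase_eq_inner (k : d → ℤ) (v : 𝔼) : fourierPhase k v = 2 * π * ⟪kVec k, v⟫_ℝ := by
  rw [fourierPhase, inner_eq_sum_apply]
  rfl

/-- `|θ_k(v)| ≤ 2π |k| |v|`. [folklore] -/
theorem abs_fourierPhase_le (k : d → ℤ) (v : 𝔼) : |fourierPhase k v| ≤ 2 * π * ‖kVec k‖ * ‖v‖ := by
  rw [fourierPhase_eq_inner, abs_mul, abs_of_pos Real.two_pi_pos, mul_assoc (2 * π)]
  exact mul_le_mul_of_nonneg_left (abs_real_inner_le_norm (kVec k) v) Real.two_pi_pos.le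

/-- The *corrector phase* `p(v) = 2π k·b(v)` built on the corrector `b` of (6.5); it solves
`L p = θ_k` (`ae_correctorPhase_eq`) and enters the first-order Hilbert expansion as
`ρ₁ = -b·∇ρ ↔ -i p ρ̂`. [cite: BodineauGallagherSaintRaymondInvent2016, (6.5)–(6.6)] -/
def correctorPhase (k : d → ℤ) (b : 𝔼 → 𝔼) (v : 𝔼) : ℝ := 2 * π * ⟪kVec k, b v⟫_ℝ

/-- The decay rate `λ = 4π² κ_β |k|²` of the `k`-th Fourier mode of the heat flow
`∂_τ ρ = κ_β Δ ρ` on the unit torus. [cite: BodineauGallagherSaintRaymondInvent2016, (2.11) and (6.8)] -/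
def heatRate (β : ℝ) (b : 𝔼 → 𝔼) (k : d → ℤ) : ℝ := 4 * π ^ 2 * bgsrDiffusionCoeff β b * ‖kVec k‖ ^ 2

/-- `|p(v)| ≤ 2π |k| |b(v)|`. [folklore] -/
theorem abs_correctorPhase_le (k : d → ℤ) (b : 𝔼 → 𝔼) (v : 𝔼) :
    |correctorPhase k b v| ≤ 2 * π * ‖kVec k‖ * ‖b v‖ := by
  rw [correctorPhase, abs_mul, abs_of_pos Real.two_pi_pos, mul_assoc (2 * π)]
  exact mul_le_mul_of_nonneg_left (abs_real_inner_le_norm (kVec k) (b v)) Real.two_pi_pos.le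

section Corrector

variable (hd : 2 ≤ Fintype.card d) (hβ : 0 < β) {b : EuclideanSpace ℝ d → EuclideanSpace ℝ d}
  (hb : IsDiffusionCorrector β b) (k : d → ℤ)

include hb in
/-- The corrector phase is measurable. [folklore] -/
theorem measurable_correctorPhase : Measurable (correctorPhase k b) :=
  measurable_const.mul ((continuous_const.inner continuous_id).measurable.comp hb.1)

include hβ hb in
/-- **The corrector phase has finite energy**: `∫ p² a_β M_β < ∞` (`p² ≤ 4π²|k|² |b|²`).
[folklore] -/
theorem finiteEnergy_correctorPhase : FiniteEnergy β (correctorPhase k b) := by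
  refine ⟨measurable_correctorPhase hb k, ?_⟩
  refine (hb.2.1.const_mul ((2 * π * ‖kVec k‖) ^ 2)).mono' ?_ (Eventually.of_forall fun v => ?_)
  · exact (((measurable_correctorPhase hb k).pow_const 2).mul (continuous_collisionFrequency hβ).measurable).mul
      (KineticTheory.measurable_maxwellianBeta β) |>.aestronglyMeasurable
  · have ha := TaggedLinearBoltzmannSeries.collisionFrequency_nonneg hβ v
    have hM := (maxwellianBeta_pos hβ v).le
    rw [Real.norm_of_nonneg (mul_nonneg (mul_nonneg (sq_nonneg _) ha) hM)]
    have h1 : correctorPhase k b v ^ 2 ≤ (2 * π * ‖kVec k‖) ^ 2 * ‖b v‖ ^ 2 := by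
      rw [← mul_pow, ← sq_abs]
      exact pow_le_pow_left₀ (abs_nonneg _) (abs_correctorPhase_le k b v) 2
    calc correctorPhase k b v ^ 2 * collisionFrequency β v * maxwellianBeta β v
        ≤ (2 * π * ‖kVec k‖) ^ 2 * ‖b v‖ ^ 2 * collisionFrequency β v * maxwellianBeta β v := by gcongr
      _ = (2 * π * ‖kVec k‖) ^ 2 * (‖b v‖ ^ 2 * collisionFrequency β v * maxwellianBeta β v) := by ring

include hd hβ hb in
/-- **The corrector phase solves `L p = θ_k`** in Carleman form: `a_β p - K p = θ_k` a.e.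
(from `L bᵢ = vᵢ` componentwise). [cite: BodineauGallagherSaintRaymondInvent2016, (6.5)] -/
theorem ae_correctorPhase_eq :
    ∀ᵐ v : 𝔼, collisionFrequency β v * correctorPhase k b v - carlemanGain β (correctorPhase k b) v =
      fourierPhase k v := by
  have hint1 : ∀ j, ∀ᵐ v : 𝔼, Integrable fun u => carlemanKernel β v u * b (v + u) j := by
    intro j
    have h := ae_integrable_carlemanKernel_mul hd hβ (hb.finiteEnergy_apply hβ j).measurable
      (hb.finiteEnergy_apply hβ j).integrable
    exact h
  have hint : ∀ᵐ v : 𝔼, ∀ j, Integrable fun u => carlemanKernel β v u * b (v + u) j := ae_all_iff.2 hint1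
  have heq1 : ∀ j, ∀ᵐ v : 𝔼, collisionFrequency β v * b v j - carlemanGain β (fun w => b w j) v = v j :=
    fun j => hb.ae_sub_carlemanGain_eq hd hβ j
  have heq : ∀ᵐ v : 𝔼, ∀ j, collisionFrequency β v * b v j - carlemanGain β (fun w => b w j) v = v j :=
    ae_all_iff.2 heq1
  filter_upwards [hint, heq] with v hv hw
  have hK : carlemanGain β (correctorPhase k b) v = 2 * π * ∑ j, (k j : ℝ) * carlemanGain β (fun w => b w j) v := by
    rw [carlemanGain]
    have h1 : (fun u => carlemanKernel β v u * correctorPhase k b (v + u)) =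
        fun u => ∑ j, 2 * π * (k j : ℝ) * (carlemanKernel β v u * b (v + u) j) := by
      funext u
      rw [correctorPhase, inner_eq_sum_apply, Finset.mul_sum, Finset.mul_sum]
      refine Finset.sum_congr rfl fun j _ => ?_
      rw [kVec_apply]; ring
    rw [h1, integral_finsetSum _ fun j _ => (hv j).const_mul _, Finset.mul_sum]
    refine Finset.sum_congr rfl fun j _ => ?_
    rw [integral_const_mul, carlemanGain]; ring
  have hp : correctorPhase k b v = 2 * π * ∑ j, (k j : ℝ) * b v j := by
    rw [correctorPhase, inner_eq_sum_apply]; simp only [kVec_apply]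
  have hθ : fourierPhase k v = 2 * π * ∑ j, (k j : ℝ) * v j := rfl
  rw [hK, hp, hθ]
  have h3 : ∑ j, (k j : ℝ) * v j =
      ∑ j, ((k j : ℝ) * (collisionFrequency β v * b v j) - (k j : ℝ) * carlemanGain β (fun w => b w j) v) :=
    Finset.sum_congr rfl fun j _ => by rw [← hw j]; ring
  have h4 : ∑ j, (k j : ℝ) * (collisionFrequency β v * b v j) = collisionFrequency β v * ∑ j, (k j : ℝ) * b v j := by
    rw [Finset.mul_sum]; exact Finset.sum_congr rfl fun j _ => by ring
  rw [h3, Finset.sum_sub_distrib, h4]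
  ring

include hd hβ hb in
/-- **`∫ θ_k p M_β = λ`** (`= 4π² ∫ (k·v)(k·b) M_β = 4π² κ_β |k|²`, the isotropy of the diffusion
matrix). [cite: BodineauGallagherSaintRaymondInvent2016, (6.8)] -/
theorem integral_fourierPhase_mul_correctorPhase :
    ∫ v, fourierPhase k v * correctorPhase k b v * maxwellianBeta β v = heatRate β b k := by
  have h := hb.integral_inner_mul_inner hd hβ (kVec k)
  simp_rw [fourierPhase_eq_inner, correctorPhase]
  rw [heatRate, mul_assoc (4 * π ^ 2), ← h, ← integral_const_mul]
  refine integral_congr_ae (Eventually.of_forall fun v => ?_)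
  ring

include hd hβ hb in
/-- `λ ≥ 0`. [folklore] -/
theorem heatRate_nonneg : 0 ≤ heatRate β b k := by
  have hκ : 0 < bgsrDiffusionCoeff β b := bgsr_diffusionCoeff_pos_holds hd hβ b hb
  unfold heatRate
  positivity

/-- `λ = 0` for `k = 0`. [folklore] -/
theorem heatRate_zero (β : ℝ) (b : 𝔼 → 𝔼) : heatRate β b (0 : d → ℤ) = 0 := by
  simp [heatRate]

/-- `p = 0` for `k = 0`. [folklore] -/
theorem correctorPhase_zero (b : 𝔼 → 𝔼) : correctorPhase (0 : d → ℤ) b = 0 := by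
  funext v; simp [correctorPhase]

/-- `θ_0 = 0`. [folklore] -/
theorem fourierPhase_zero : fourierPhase (0 : d → ℤ) = fun _ : 𝔼 => 0 := by
  funext v; simp [fourierPhase]

end Corrector

/-! ## Integrability toolbox: the majorant `W = (1 + |p|)² (1 + a_β) M_β` -/

section Majorant

variable (hd : 2 ≤ Fintype.card d) (hβ : 0 < β) {b : EuclideanSpace ℝ d → EuclideanSpace ℝ d}
  (hb : IsDiffusionCorrector β b) (k : d → ℤ)

/-- The integrable majorant `W(v) = (1 + |p(v)|)² (1 + a_β(v)) M_β(v)` dominating every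
integrand of the energy computation. [folklore] -/
def energyMajorant (β : ℝ) (b : 𝔼 → 𝔼) (k : d → ℤ) (v : 𝔼) : ℝ :=
  (1 + |correctorPhase k b v|) ^ 2 * (1 + collisionFrequency β v) * maxwellianBeta β v

include hβ in
/-- `W ≥ 0`. [folklore] -/
theorem energyMajorant_nonneg (v : 𝔼) : 0 ≤ energyMajorant β b k v :=
  mul_nonneg (mul_nonneg (sq_nonneg _) (by linarith [TaggedLinearBoltzmannSeries.collisionFrequency_nonneg hβ v]))
    (maxwellianBeta_pos hβ v).le

include hβ hb in
/-- `W` is measurable. [folklore] -/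
theorem measurable_energyMajorant : Measurable (energyMajorant β b k) :=
  ((((measurable_correctorPhase hb k).abs.const_add 1).pow_const 2).mul
    ((continuous_collisionFrequency hβ).measurable.const_add 1)).mul (KineticTheory.measurable_maxwellianBeta β)

include hd hβ hb in
/-- **`W` is integrable** (`p` has finite energy, `a_β M_β` and `M_β` are integrable, `a_β ≥ a₀ > 0`).
[folklore] -/
theorem integrable_energyMajorant : Integrable (energyMajorant β b k) := by
  obtain ⟨a₀, ha₀, c, hc, hlow⟩ := exists_collisionFrequency_lowerBound (d := d) hd hβ
  have hp := finiteEnergy_correctorPhase hβ hb k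
  have h1 : Integrable fun v : 𝔼 => maxwellianBeta β v := KineticTheory.integrable_maxwellianBeta hβ
  have h2 : Integrable fun v : 𝔼 => collisionFrequency β v * maxwellianBeta β v :=
    integrable_collisionFrequency_mul_maxwellianBeta hβ
  have h3 := hp.integrable
  -- `(1 + |p|)² (1 + a) ≤ 2 (1 + p²)(1 + a) ≤ 2 (1 + a₀⁻¹) (M-integrable combination)`
  have hdom : Integrable fun v : 𝔼 => 2 * ((1 + a₀⁻¹) * (collisionFrequency β v * maxwellianBeta β v) +
      (1 + a₀⁻¹) * (correctorPhase k b v ^ 2 * collisionFrequency β v * maxwellianBeta β v)) :=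
    ((h2.const_mul _).add (h3.const_mul _)).const_mul 2
  refine hdom.mono' (measurable_energyMajorant hβ hb k).aestronglyMeasurable (Eventually.of_forall fun v => ?_)
  have ha := (hlow v).1
  have hM := (maxwellianBeta_pos hβ v).le
  have hapos : 0 < collisionFrequency β v := ha₀.trans_le ha
  rw [Real.norm_of_nonneg (energyMajorant_nonneg hβ k v), energyMajorant]
  have hsq : (1 + |correctorPhase k b v|) ^ 2 ≤ 2 * (1 + correctorPhase k b v ^ 2) := by
    nlinarith [sq_nonneg (1 - |correctorPhase k b v|), sq_abs (correctorPhase k b v)]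
  have h1a : 1 + collisionFrequency β v ≤ (1 + a₀⁻¹) * collisionFrequency β v := by
    rw [add_mul, one_mul, add_comm]
    gcongr
    rw [← div_eq_inv_mul, le_div_iff₀ ha₀, one_mul]
    exact ha
  calc (1 + |correctorPhase k b v|) ^ 2 * (1 + collisionFrequency β v) * maxwellianBeta β v
      ≤ 2 * (1 + correctorPhase k b v ^ 2) * ((1 + a₀⁻¹) * collisionFrequency β v) * maxwellianBeta β v := by
        gcongr
    _ = 2 * ((1 + a₀⁻¹) * (collisionFrequency β v * maxwellianBeta β v) +
          (1 + a₀⁻¹) * (correctorPhase k b v ^ 2 * collisionFrequency β v * maxwellianBeta β v)) := by ring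

include hd hβ hb in
/-- Anything measurable and dominated by a multiple of `W` is integrable. [folklore] -/
theorem integrable_of_le_energyMajorant {f : 𝔼 → ℝ} (hf : Measurable f) (C : ℝ)
    (hle : ∀ v, ‖f v‖ ≤ C * energyMajorant β b k v) : Integrable f :=
  ((integrable_energyMajorant hd hβ hb k).const_mul C).mono' hf.aestronglyMeasurable (Eventually.of_forall hle)

include hd hβ in
/-- `|θ_k| ≤ C_θ a_β` for some constant `C_θ ≥ 0`. [folklore] -/
theorem exists_abs_fourierPhase_le_mul_collisionFrequency :
    ∃ Cθ : ℝ, 0 ≤ Cθ ∧ ∀ v : 𝔼, |fourierPhase k v| ≤ Cθ * collisionFrequency β v := by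
  obtain ⟨a₀, ha₀, c, hc, hlow⟩ := exists_collisionFrequency_lowerBound (d := d) hd hβ
  refine ⟨2 * π * ‖kVec k‖ / c, by positivity, fun v => ?_⟩
  calc |fourierPhase k v| ≤ 2 * π * ‖kVec k‖ * ‖v‖ := abs_fourierPhase_le k v
    _ = 2 * π * ‖kVec k‖ / c * (c * ‖v‖) := by field_simp
    _ ≤ 2 * π * ‖kVec k‖ / c * collisionFrequency β v :=
        mul_le_mul_of_nonneg_left (hlow v).2 (by positivity)

end Majorant

/-! ## The first-order expansion and the remainder -/

section Expansion

open Literature.Analysis.FluidPDE Literature.Analysis.FunctionSpaces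

/-- The `k`-th Fourier coefficient `ρ̂⁰(k)` of the datum. [folklore] -/
def datumCoeff (ρ₀ : 𝕋 → ℝ) (k : d → ℤ) : ℂ := mFourierCoeff (fun x => (ρ₀ x : ℂ)) k

/-- The fibre `ψ_k(t, v)` of the collision-series solution with datum `ρ⁰`. [folklore] -/
def seriesFibre (β α : ℝ) (ρ₀ : 𝕋 → ℝ) (k : d → ℤ) (t : ℝ) (v : 𝔼) : ℂ :=
  kineticFibre k (linearBoltzmannSeries (Torus.geometry d) β α (fun x _ => ρ₀ x) t) v

/-- **The first-order Hilbert expansion** of the `k`-th fibre: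
`Ψ(t, v) = ρ̂⁰(k) e^{-λt/α} (1 - i α⁻¹ p(v))` (BGSR's `ρ + α⁻¹ ρ₁`, `ρ₁ = -b·∇ρ`, on the mode `k`,
in the kinetic time `t = ατ`). [cite: BodineauGallagherSaintRaymondInvent2016, (6.4)–(6.6)] -/
def fibreExpansion (β α : ℝ) (b : 𝔼 → 𝔼) (k : d → ℤ) (g₀ : ℂ) (t : ℝ) (v : 𝔼) : ℂ :=
  g₀ * (Real.exp (-(heatRate β b k / α * t)) : ℂ) * (1 - I * ((α⁻¹ * correctorPhase k b v : ℝ) : ℂ))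

/-- **The remainder** `R = Ψ - ψ_k`. [folklore] -/
def fibreRemainder (β α : ℝ) (b : 𝔼 → 𝔼) (ρ₀ : 𝕋 → ℝ) (k : d → ℤ) (t : ℝ) (v : 𝔼) : ℂ :=
  fibreExpansion β α b k (datumCoeff ρ₀ k) t v - seriesFibre β α ρ₀ k t v

/-- **The energy** `y(t) = ∫ |R(t, v)|² M_β(v) dv`. [folklore] -/
def fibreEnergy (β α : ℝ) (b : 𝔼 → 𝔼) (ρ₀ : 𝕋 → ℝ) (k : d → ℤ) (t : ℝ) : ℝ :=
  ∫ v, ‖fibreRemainder β α b ρ₀ k t v‖ ^ 2 * maxwellianBeta β v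

variable {b : EuclideanSpace ℝ d → EuclideanSpace ℝ d} {ρ₀ : UnitAddTorus d → ℝ} {Rb : ℝ} {k : d → ℤ}

/-- `|ρ̂⁰(k)| ≤ sup |ρ⁰|`. [folklore] -/
theorem norm_datumCoeff_le {C : ℝ} (hC : ∀ x, |ρ₀ x| ≤ C) (k : d → ℤ) : ‖datumCoeff ρ₀ k‖ ≤ C := by
  haveI : Nonempty d ∨ IsEmpty d := (isEmpty_or_nonempty d).symm
  have h := norm_kineticFibre_le k (φ := fun x (_ : 𝔼) => ρ₀ x) (fun x _ => hC x) 0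
  simpa [kineticFibre, datumCoeff] using h

/-- The time factor `e^{-λt/α}` is at most `1` for `t ≥ 0` (when `λ/α ≥ 0`). [folklore] -/
theorem exp_heatRate_le_one {lam α t : ℝ} (hlam : 0 ≤ lam / α) (ht : 0 ≤ t) : Real.exp (-(lam / α * t)) ≤ 1 := by
  rw [Real.exp_le_one_iff, neg_nonpos]; exact mul_nonneg hlam ht

/-- **Pointwise bound on the expansion**: `|Ψ(t, v)| ≤ |ρ̂⁰(k)| e^{-λt/α} (1 + |p(v)|)` for `α ≥ 1`.
[folklore] -/
theorem norm_fibreExpansion_le (hα : 1 ≤ α) (g₀ : ℂ) (t : ℝ) (v : 𝔼) :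
    ‖fibreExpansion β α b k g₀ t v‖ ≤ ‖g₀‖ * Real.exp (-(heatRate β b k / α * t)) * (1 + |correctorPhase k b v|) := by
  rw [fibreExpansion, norm_mul, norm_mul, Complex.norm_real, Real.norm_of_nonneg (Real.exp_nonneg _)]
  refine mul_le_mul_of_nonneg_left ?_ (mul_nonneg (norm_nonneg _) (Real.exp_nonneg _))
  calc ‖(1 : ℂ) - I * ((α⁻¹ * correctorPhase k b v : ℝ) : ℂ)‖
      ≤ ‖(1 : ℂ)‖ + ‖I * ((α⁻¹ * correctorPhase k b v : ℝ) : ℂ)‖ := norm_sub_le _ _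
    _ = 1 + α⁻¹ * |correctorPhase k b v| := by
        rw [norm_one, norm_mul, Complex.norm_I, one_mul, Complex.norm_real, Real.norm_eq_abs, abs_mul,
          abs_of_pos (inv_pos.2 (by linarith))]
    _ ≤ 1 + |correctorPhase k b v| := by
        gcongr
        exact mul_le_of_le_one_left (abs_nonneg _) (inv_le_one_of_one_le₀ hα)

/-- The expansion is measurable in `v`. [folklore] -/
theorem measurable_fibreExpansion (hb : IsDiffusionCorrector β b) (g₀ : ℂ) (t : ℝ) :
    Measurable fun v => fibreExpansion β α b k g₀ t v := by
  unfold fibreExpansion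
  exact measurable_const.mul (measurable_const.sub (measurable_const.mul
    (Complex.measurable_ofReal.comp ((measurable_correctorPhase hb k).const_mul _))))

/-- **Time derivative of the expansion**: `∂ₜ Ψ = -(λ/α) Ψ`. [folklore] -/
theorem hasDerivAt_fibreExpansion (g₀ : ℂ) (t : ℝ) (v : 𝔼) :
    HasDerivAt (fun s => fibreExpansion β α b k g₀ s v) (-((heatRate β b k / α : ℝ) : ℂ) * fibreExpansion β α b k g₀ t v) t := by
  set c : ℂ := -((heatRate β b k / α : ℝ) : ℂ) with hc
  set X : ℂ := 1 - I * ((α⁻¹ * correctorPhase k b v : ℝ) : ℂ) with hX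
  have hcast : ∀ s : ℝ, ((-(heatRate β b k / α * s) : ℝ) : ℂ) = c * s := fun s => by
    rw [hc]; push_cast; ring
  have hfun : (fun s => fibreExpansion β α b k g₀ s v) = fun s : ℝ => g₀ * Complex.exp (c * s) * X := by
    funext s
    rw [fibreExpansion, Complex.ofReal_exp, hcast]
  have h1 : HasDerivAt (fun s : ℝ => c * (s : ℂ)) c t := by
    simpa using (Complex.ofRealCLM.hasDerivAt (x := t)).const_mul c
  have h2 := (Complex.hasDerivAt_exp (c * t)).comp t h1
  have h3 : HasDerivAt (fun s : ℝ => Complex.exp (c * s)) (Complex.exp (c * t) * c) t := h2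
  have h4 := (h3.const_mul g₀).mul_const X
  have hval : fibreExpansion β α b k g₀ t v = g₀ * Complex.exp (c * t) * X := congrFun hfun t
  have h5 : g₀ * (Complex.exp (c * t) * c) * X = c * (g₀ * Complex.exp (c * t) * X) := by ring
  rw [hval, hfun, ← h5]
  exact h4

end Expansion

/-! ## The remainder: derivative, bounds, and the energy functional -/

section Remainder

open Literature.Analysis.FluidPDE Literature.Analysis.FunctionSpaces

variable {b : EuclideanSpace ℝ d → EuclideanSpace ℝ d} {ρ₀ : UnitAddTorus d → ℝ} {ϱ : ℝ} {k : d → ℤ}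

/-- `|ψ_k(t, v)| ≤ ϱ` for the series with datum `0 ≤ ρ⁰ ≤ ϱ`. [folklore] -/
theorem norm_seriesFibre_le (h : LinearBoltzmannData (Torus.geometry d) β α (fun x _ => ρ₀ x) ϱ) (k : d → ℤ)
    (t : ℝ) (v : 𝔼) : ‖seriesFibre β α ρ₀ k t v‖ ≤ ϱ :=
  norm_kineticFibre_le k (fun x w => h.abs_linearBoltzmannSeries_le t x w) v

/-- `0 ≤ ϱ`. [folklore] -/
theorem LinearBoltzmannData.bound_nonneg [Nonempty d] (h : LinearBoltzmannData (Torus.geometry d) β α (fun x _ => ρ₀ x) ϱ) :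
    0 ≤ ϱ :=
  (h.data_nonneg (0 : 𝕋) (0 : 𝔼)).trans (h.data_le 0 0)

/-- `(t, v) ↦ ψ_k(t, v)` is continuous. [folklore] -/
theorem continuous_seriesFibre (h : LinearBoltzmannData (Torus.geometry d) β α (fun x _ => ρ₀ x) ϱ) (k : d → ℤ) :
    Continuous fun p : ℝ × 𝔼 => seriesFibre β α ρ₀ k p.1 p.2 :=
  continuous_kineticFibre k h.continuous_linearBoltzmannSeries

/-- `|K ψ_k(t)(v)| ≤ a_β(v) ϱ`. [folklore] -/
theorem norm_carlemanGainC_seriesFibre_le (h : LinearBoltzmannData (Torus.geometry d) β α (fun x _ => ρ₀ x) ϱ)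
    (hd : 2 ≤ Fintype.card d) (k : d → ℤ) (t : ℝ) (v : 𝔼) :
    ‖carlemanGainC β (seriesFibre β α ρ₀ k t) v‖ ≤ collisionFrequency β v * ϱ :=
  norm_carlemanGainC_le hd h.beta_pos (fun w => norm_seriesFibre_le h k t w) v

/-- The derivative `R'(t, v) = -(λ/α) Ψ - (-(α a_β + iθ_k) ψ_k + α K ψ_k)` of the remainder. [folklore] -/
def fibreRemainderDeriv (β α : ℝ) (b : 𝔼 → 𝔼) (ρ₀ : 𝕋 → ℝ) (k : d → ℤ) (t : ℝ) (v : 𝔼) : ℂ :=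
  -((heatRate β b k / α : ℝ) : ℂ) * fibreExpansion β α b k (datumCoeff ρ₀ k) t v -
    (-(((α * collisionFrequency β v : ℝ) : ℂ) + fourierPhase k v * I) * seriesFibre β α ρ₀ k t v +
      (α : ℂ) * carlemanGainC β (seriesFibre β α ρ₀ k t) v)

/-- **The remainder is differentiable in time** (`t > 0`), with derivative `fibreRemainderDeriv`.
[folklore] -/
theorem hasDerivAt_fibreRemainder (h : LinearBoltzmannData (Torus.geometry d) β α (fun x _ => ρ₀ x) ϱ)
    (hd : 2 ≤ Fintype.card d) (k : d → ℤ) {t : ℝ} (ht : 0 < t) (v : 𝔼) :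
    HasDerivAt (fun s => fibreRemainder β α b ρ₀ k s v) (fibreRemainderDeriv β α b ρ₀ k t v) t :=
  (hasDerivAt_fibreExpansion (datumCoeff ρ₀ k) t v).sub (hasDerivAt_kineticFibre h hd k ht v)

/-- **Bound on the remainder** for `t ≥ 0`, `α ≥ 1`: `|R(t, v)| ≤ |ρ̂⁰(k)| (1 + |p(v)|) + ϱ`. [folklore] -/
theorem norm_fibreRemainder_le (h : LinearBoltzmannData (Torus.geometry d) β α (fun x _ => ρ₀ x) ϱ)
    (hd : 2 ≤ Fintype.card d) (hb : IsDiffusionCorrector β b) (hα : 1 ≤ α) (k : d → ℤ) {t : ℝ} (ht : 0 ≤ t) (v : 𝔼) :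
    ‖fibreRemainder β α b ρ₀ k t v‖ ≤ ‖datumCoeff ρ₀ k‖ * (1 + |correctorPhase k b v|) + ϱ := by
  have hβ := h.beta_pos
  have hlam : 0 ≤ heatRate β b k / α := div_nonneg (heatRate_nonneg hd hβ hb k) (by linarith)
  calc ‖fibreRemainder β α b ρ₀ k t v‖
      ≤ ‖fibreExpansion β α b k (datumCoeff ρ₀ k) t v‖ + ‖seriesFibre β α ρ₀ k t v‖ := norm_sub_le _ _
    _ ≤ ‖datumCoeff ρ₀ k‖ * Real.exp (-(heatRate β b k / α * t)) * (1 + |correctorPhase k b v|) + ϱ :=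
        add_le_add (norm_fibreExpansion_le hα _ t v) (norm_seriesFibre_le h k t v)
    _ ≤ ‖datumCoeff ρ₀ k‖ * 1 * (1 + |correctorPhase k b v|) + ϱ := by
        gcongr
        exact exp_heatRate_le_one hlam ht
    _ = _ := by rw [mul_one]

/-- **Bound on the derivative of the remainder** for `t ≥ 0`, `α ≥ 1`:
`|R'(t, v)| ≤ (λ/α) |ρ̂⁰(k)| (1 + |p|) + ((α a_β + |θ_k|) + α a_β) ϱ`. [folklore] -/
theorem norm_fibreRemainderDeriv_le (h : LinearBoltzmannData (Torus.geometry d) β α (fun x _ => ρ₀ x) ϱ)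
    (hd : 2 ≤ Fintype.card d) (hb : IsDiffusionCorrector β b) (hα : 1 ≤ α) (k : d → ℤ) {t : ℝ} (ht : 0 ≤ t) (v : 𝔼) :
    ‖fibreRemainderDeriv β α b ρ₀ k t v‖ ≤
      heatRate β b k / α * (‖datumCoeff ρ₀ k‖ * (1 + |correctorPhase k b v|)) +
        ((α * collisionFrequency β v + |fourierPhase k v|) * ϱ + α * (collisionFrequency β v * ϱ)) := by
  haveI : Nonempty d := Fintype.card_pos_iff.1 (by omega)
  have hβ := h.beta_pos
  have hα0 : 0 ≤ α := by linarith
  have hlam : 0 ≤ heatRate β b k / α := div_nonneg (heatRate_nonneg hd hβ hb k) (by linarith)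
  have ha := TaggedLinearBoltzmannSeries.collisionFrequency_nonneg hβ v
  have hϱ := h.bound_nonneg
  rw [fibreRemainderDeriv]
  refine (norm_sub_le _ _).trans (add_le_add ?_ ((norm_add_le _ _).trans (add_le_add ?_ ?_)))
  · rw [norm_mul, norm_neg, Complex.norm_real, Real.norm_of_nonneg hlam]
    refine mul_le_mul_of_nonneg_left ?_ hlam
    calc ‖fibreExpansion β α b k (datumCoeff ρ₀ k) t v‖
        ≤ ‖datumCoeff ρ₀ k‖ * Real.exp (-(heatRate β b k / α * t)) * (1 + |correctorPhase k b v|) :=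
          norm_fibreExpansion_le hα _ t v
      _ ≤ ‖datumCoeff ρ₀ k‖ * 1 * (1 + |correctorPhase k b v|) := by
          gcongr; exact exp_heatRate_le_one hlam ht
      _ = _ := by rw [mul_one]
  · rw [norm_mul, norm_neg]
    refine mul_le_mul ?_ (norm_seriesFibre_le h k t v) (norm_nonneg _) (by positivity)
    calc ‖((α * collisionFrequency β v : ℝ) : ℂ) + fourierPhase k v * I‖
        ≤ ‖((α * collisionFrequency β v : ℝ) : ℂ)‖ + ‖(fourierPhase k v : ℂ) * I‖ := norm_add_le _ _
      _ = α * collisionFrequency β v + |fourierPhase k v| := by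
          rw [Complex.norm_real, Real.norm_of_nonneg (mul_nonneg hα0 ha), norm_mul, Complex.norm_I, mul_one,
            Complex.norm_real, Real.norm_eq_abs]
  · rw [norm_mul, Complex.norm_real, Real.norm_of_nonneg hα0]
    exact mul_le_mul_of_nonneg_left (norm_carlemanGainC_seriesFibre_le h hd k t v) hα0

/-- The remainder is measurable in `v`. [folklore] -/
theorem measurable_fibreRemainder (h : LinearBoltzmannData (Torus.geometry d) β α (fun x _ => ρ₀ x) ϱ)
    (hb : IsDiffusionCorrector β b) (k : d → ℤ) (t : ℝ) : Measurable fun v => fibreRemainder β α b ρ₀ k t v :=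
  (measurable_fibreExpansion hb _ t).sub ((continuous_seriesFibre h k).measurable.comp
    (measurable_const.prodMk measurable_id))

/-- The remainder is continuous in `t` for every `v`. [folklore] -/
theorem continuous_fibreRemainder_left (h : LinearBoltzmannData (Torus.geometry d) β α (fun x _ => ρ₀ x) ϱ)
    (k : d → ℤ) (v : 𝔼) : Continuous fun t => fibreRemainder β α b ρ₀ k t v := by
  refine Continuous.sub ?_ ((continuous_seriesFibre h k).comp (continuous_id.prodMk continuous_const))
  unfold fibreExpansion
  fun_prop

/-- **Continuity of the energy functional** `y(t) = ∫ |R(t)|² M_β`. [folklore] -/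
theorem continuous_fibreEnergy (h : LinearBoltzmannData (Torus.geometry d) β α (fun x _ => ρ₀ x) ϱ)
    (hd : 2 ≤ Fintype.card d) (hb : IsDiffusionCorrector β b) (hα : 1 ≤ α) (k : d → ℤ) :
    Continuous (fibreEnergy β α b ρ₀ k) := by
  haveI : Nonempty d := Fintype.card_pos_iff.1 (by omega)
  have hβ := h.beta_pos
  have hϱ := h.bound_nonneg
  refine continuous_iff_continuousAt.2 fun t₀ => ?_
  -- a uniform majorant on `ball t₀ 1`
  set E := Real.exp (heatRate β b k / α * (|t₀| + 1)) with hE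
  set g := ‖datumCoeff ρ₀ k‖ with hg
  have hlam : 0 ≤ heatRate β b k / α := div_nonneg (heatRate_nonneg hd hβ hb k) (by linarith)
  have hexp : ∀ t ∈ ball t₀ 1, Real.exp (-(heatRate β b k / α * t)) ≤ E := by
    intro t ht
    rw [hE, Real.exp_le_exp]
    have h1 : -t ≤ |t₀| + 1 := by
      have := mem_ball_iff_norm.1 ht
      rw [Real.norm_eq_abs] at this
      have h2 : |t| ≤ |t₀| + 1 := by
        calc |t| = |t₀ + (t - t₀)| := by ring_nf
          _ ≤ |t₀| + |t - t₀| := abs_add_le _ _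
          _ ≤ |t₀| + 1 := by linarith [this.le]
      linarith [neg_abs_le t]
    calc -(heatRate β b k / α * t) = heatRate β b k / α * (-t) := by ring
      _ ≤ heatRate β b k / α * (|t₀| + 1) := mul_le_mul_of_nonneg_left h1 hlam
  refine continuousAt_of_dominated (bound := fun v => 2 * ((g * E) ^ 2 + ϱ ^ 2) * energyMajorant β b k v) ?_ ?_ ?_ ?_
  · exact Eventually.of_forall fun t => (((measurable_fibreRemainder h hb k t).norm.pow_const 2).mul
      (KineticTheory.measurable_maxwellianBeta β)).aestronglyMeasurable
  · filter_upwards [ball_mem_nhds t₀ one_pos] with t ht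
    refine Eventually.of_forall fun v => ?_
    have hM := (maxwellianBeta_pos hβ v).le
    have ha := TaggedLinearBoltzmannSeries.collisionFrequency_nonneg hβ v
    rw [Real.norm_of_nonneg (mul_nonneg (sq_nonneg _) hM), energyMajorant]
    have hR : ‖fibreRemainder β α b ρ₀ k t v‖ ≤ g * E * (1 + |correctorPhase k b v|) + ϱ := by
      calc ‖fibreRemainder β α b ρ₀ k t v‖
          ≤ ‖fibreExpansion β α b k (datumCoeff ρ₀ k) t v‖ + ‖seriesFibre β α ρ₀ k t v‖ := norm_sub_le _ _
        _ ≤ g * Real.exp (-(heatRate β b k / α * t)) * (1 + |correctorPhase k b v|) + ϱ :=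
            add_le_add (norm_fibreExpansion_le hα _ t v) (norm_seriesFibre_le h k t v)
        _ ≤ g * E * (1 + |correctorPhase k b v|) + ϱ := by gcongr; exact hexp t ht
    have hP : 0 ≤ 1 + |correctorPhase k b v| := by positivity
    have hgE : 0 ≤ g * E := by positivity
    calc ‖fibreRemainder β α b ρ₀ k t v‖ ^ 2 * maxwellianBeta β v
        ≤ (g * E * (1 + |correctorPhase k b v|) + ϱ) ^ 2 * maxwellianBeta β v := by gcongr
      _ ≤ (2 * ((g * E) ^ 2 + ϱ ^ 2) * ((1 + |correctorPhase k b v|) ^ 2 * (1 + collisionFrequency β v))) *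
            maxwellianBeta β v := by
          refine mul_le_mul_of_nonneg_right ?_ hM
          have h1 : (g * E * (1 + |correctorPhase k b v|) + ϱ) ^ 2 ≤
              2 * ((g * E) ^ 2 + ϱ ^ 2) * (1 + |correctorPhase k b v|) ^ 2 := by
            nlinarith [sq_nonneg (g * E * (1 + |correctorPhase k b v|) - ϱ), sq_nonneg (|correctorPhase k b v|),
              mul_nonneg hgE hP, abs_nonneg (correctorPhase k b v), sq_nonneg ϱ,
              mul_nonneg (sq_nonneg ϱ) (abs_nonneg (correctorPhase k b v))]
          calc (g * E * (1 + |correctorPhase k b v|) + ϱ) ^ 2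
              ≤ 2 * ((g * E) ^ 2 + ϱ ^ 2) * (1 + |correctorPhase k b v|) ^ 2 := h1
            _ = 2 * ((g * E) ^ 2 + ϱ ^ 2) * ((1 + |correctorPhase k b v|) ^ 2 * 1) := by ring
            _ ≤ 2 * ((g * E) ^ 2 + ϱ ^ 2) * ((1 + |correctorPhase k b v|) ^ 2 * (1 + collisionFrequency β v)) := by
                gcongr; linarith
      _ = 2 * ((g * E) ^ 2 + ϱ ^ 2) * ((1 + |correctorPhase k b v|) ^ 2 * (1 + collisionFrequency β v) *
            maxwellianBeta β v) := by ring
  · exact (integrable_energyMajorant hd hβ hb k).const_mul _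
  · exact Eventually.of_forall fun v => (((continuous_fibreRemainder_left h k v).norm.pow 2).mul
      continuous_const).continuousAt

/-- `K g` is measurable for measurable complex `g`. [folklore] -/
theorem measurable_carlemanGainC {g : 𝔼 → ℂ} (hg : Measurable g) : Measurable (carlemanGainC β g) := by
  have hsm : StronglyMeasurable (Function.uncurry fun (v u : 𝔼) => (carlemanKernel β v u : ℂ) * g (v + u)) :=
    ((Complex.measurable_ofReal.comp (measurable_carlemanKernel β)).mul (hg.comp measurable_add)).stronglyMeasurable
  exact (hsm.integral_prod_right' (ν := (volume : Measure 𝔼))).measurable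

/-- The derivative of the remainder is measurable in `v`. [folklore] -/
theorem measurable_fibreRemainderDeriv (h : LinearBoltzmannData (Torus.geometry d) β α (fun x _ => ρ₀ x) ϱ)
    (hb : IsDiffusionCorrector β b) (k : d → ℤ) (t : ℝ) : Measurable fun v => fibreRemainderDeriv β α b ρ₀ k t v := by
  have hβ := h.beta_pos
  have hψ : Measurable fun v => seriesFibre β α ρ₀ k t v :=
    (continuous_seriesFibre h k).measurable.comp (measurable_const.prodMk measurable_id)
  unfold fibreRemainderDeriv
  refine (measurable_const.mul (measurable_fibreExpansion hb _ t)).sub ((Measurable.mul ?_ hψ).add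
    (measurable_const.mul (measurable_carlemanGainC hψ)))
  exact ((Complex.measurable_ofReal.comp ((continuous_collisionFrequency hβ).measurable.const_mul α)).add
    ((Complex.measurable_ofReal.comp (continuous_fourierPhase k).measurable).mul measurable_const)).neg

/-- **The energy functional is differentiable** for `t > 0`, with
`y'(t) = ∫ 2 ⟪R(t), R'(t)⟫ M_β` (differentiation under the integral sign, dominated by a multiple
of `W`), and the derivative integrand is integrable. [folklore] -/
theorem integrable_and_hasDerivAt_fibreEnergy (h : LinearBoltzmannData (Torus.geometry d) β α (fun x _ => ρ₀ x) ϱ)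
    (hd : 2 ≤ Fintype.card d) (hb : IsDiffusionCorrector β b) (hα : 1 ≤ α) (k : d → ℤ) {t : ℝ} (ht : 0 < t) :
    Integrable (fun v => 2 * ⟪fibreRemainder β α b ρ₀ k t v, fibreRemainderDeriv β α b ρ₀ k t v⟫_ℝ * maxwellianBeta β v) ∧
      HasDerivAt (fibreEnergy β α b ρ₀ k)
        (∫ v, 2 * ⟪fibreRemainder β α b ρ₀ k t v, fibreRemainderDeriv β α b ρ₀ k t v⟫_ℝ * maxwellianBeta β v) t := by
  haveI : Nonempty d := Fintype.card_pos_iff.1 (by omega)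
  have hβ := h.beta_pos
  have hϱ := h.bound_nonneg
  have hα0 : 0 ≤ α := by linarith
  obtain ⟨Cθ, hCθ0, hCθ⟩ := exists_abs_fourierPhase_le_mul_collisionFrequency hd hβ k
  set g := ‖datumCoeff ρ₀ k‖ with hg
  set L := heatRate β b k / α with hL
  have hL0 : 0 ≤ L := div_nonneg (heatRate_nonneg hd hβ hb k) (by linarith)
  -- the constant in front of `W` in the domination
  set C : ℝ := 2 * ((g + ϱ) * (L * g + (2 * α + Cθ) * ϱ)) with hC
  have key := hasDerivAt_integral_of_dominated_loc_of_deriv_le (μ := (volume : Measure 𝔼)) (x₀ := t)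
    (F := fun s v => ‖fibreRemainder β α b ρ₀ k s v‖ ^ 2 * maxwellianBeta β v)
    (F' := fun s v => 2 * ⟪fibreRemainder β α b ρ₀ k s v, fibreRemainderDeriv β α b ρ₀ k s v⟫_ℝ * maxwellianBeta β v)
    (s := Ioi (t / 2)) (bound := fun v => C * energyMajorant β b k v) (Ioi_mem_nhds (by linarith)) ?_ ?_ ?_ ?_ ?_ ?_
  · exact ⟨key.1, key.2⟩
  · exact Eventually.of_forall fun s => (((measurable_fibreRemainder h hb k s).norm.pow_const 2).mul
      (KineticTheory.measurable_maxwellianBeta β)).aestronglyMeasurable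
  · -- integrability of `F t`
    refine integrable_of_le_energyMajorant hd hβ hb k (((measurable_fibreRemainder h hb k t).norm.pow_const 2).mul
      (KineticTheory.measurable_maxwellianBeta β)) (2 * (g ^ 2 + ϱ ^ 2)) fun v => ?_
    have hM := (maxwellianBeta_pos hβ v).le
    have ha := TaggedLinearBoltzmannSeries.collisionFrequency_nonneg hβ v
    have hR := norm_fibreRemainder_le h hd hb hα k ht.le v
    have hP : 0 ≤ |correctorPhase k b v| := abs_nonneg _
    rw [Real.norm_of_nonneg (mul_nonneg (sq_nonneg _) hM), energyMajorant]
    calc ‖fibreRemainder β α b ρ₀ k t v‖ ^ 2 * maxwellianBeta β v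
        ≤ (g * (1 + |correctorPhase k b v|) + ϱ) ^ 2 * maxwellianBeta β v := by gcongr
      _ ≤ 2 * (g ^ 2 + ϱ ^ 2) * ((1 + |correctorPhase k b v|) ^ 2 * (1 + collisionFrequency β v)) * maxwellianBeta β v := by
          refine mul_le_mul_of_nonneg_right ?_ hM
          have h1 : (g * (1 + |correctorPhase k b v|) + ϱ) ^ 2 ≤ 2 * (g ^ 2 + ϱ ^ 2) * (1 + |correctorPhase k b v|) ^ 2 := by
            nlinarith [sq_nonneg (g * (1 + |correctorPhase k b v|) - ϱ), mul_nonneg hϱ hP, sq_nonneg ϱ,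
              mul_nonneg (sq_nonneg ϱ) hP, mul_nonneg (mul_nonneg (sq_nonneg ϱ) hP) hP]
          calc (g * (1 + |correctorPhase k b v|) + ϱ) ^ 2 ≤ 2 * (g ^ 2 + ϱ ^ 2) * (1 + |correctorPhase k b v|) ^ 2 := h1
            _ = 2 * (g ^ 2 + ϱ ^ 2) * ((1 + |correctorPhase k b v|) ^ 2 * 1) := by ring
            _ ≤ _ := by gcongr; linarith
      _ = _ := by ring
  · exact (((measurable_fibreRemainder h hb k t).inner (measurable_fibreRemainderDeriv h hb k t)).const_mul 2 |>.mul
      (KineticTheory.measurable_maxwellianBeta β)).aestronglyMeasurable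
  · -- domination of `F'` on `s`
    refine Eventually.of_forall fun v x hx => ?_
    have hx0 : 0 ≤ x := by linarith [mem_Ioi.1 hx]
    have hM := (maxwellianBeta_pos hβ v).le
    have ha := TaggedLinearBoltzmannSeries.collisionFrequency_nonneg hβ v
    have hP : 0 ≤ |correctorPhase k b v| := abs_nonneg _
    have hR := norm_fibreRemainder_le h hd hb hα k hx0 v
    have hR' := norm_fibreRemainderDeriv_le h hd hb hα k hx0 v
    rw [← hL] at hR'
    have hθ := hCθ v
    rw [Real.norm_eq_abs, abs_mul, abs_mul, abs_of_nonneg hM, abs_two, energyMajorant]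
    have hin : |⟪fibreRemainder β α b ρ₀ k x v, fibreRemainderDeriv β α b ρ₀ k x v⟫_ℝ| ≤
        (g * (1 + |correctorPhase k b v|) + ϱ) *
          (L * (g * (1 + |correctorPhase k b v|)) +
            ((α * collisionFrequency β v + |fourierPhase k v|) * ϱ + α * (collisionFrequency β v * ϱ))) :=
      (abs_real_inner_le_norm _ _).trans (mul_le_mul hR hR' (norm_nonneg _) (by positivity))
    have hA : g * (1 + |correctorPhase k b v|) + ϱ ≤ (g + ϱ) * (1 + |correctorPhase k b v|) := by
      nlinarith [mul_nonneg hϱ hP]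
    have hB : L * (g * (1 + |correctorPhase k b v|)) +
        ((α * collisionFrequency β v + |fourierPhase k v|) * ϱ + α * (collisionFrequency β v * ϱ)) ≤
        (L * g + (2 * α + Cθ) * ϱ) * ((1 + |correctorPhase k b v|) * (1 + collisionFrequency β v)) := by
      have h1 : L * (g * (1 + |correctorPhase k b v|)) ≤ L * g * ((1 + |correctorPhase k b v|) * (1 + collisionFrequency β v)) := by
        have : (1 + |correctorPhase k b v|) * 1 ≤ (1 + |correctorPhase k b v|) * (1 + collisionFrequency β v) := by
          gcongr; linarith
        nlinarith [mul_nonneg hL0 (norm_nonneg (datumCoeff ρ₀ k))]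
      have h2 : (α * collisionFrequency β v + |fourierPhase k v|) * ϱ + α * (collisionFrequency β v * ϱ) ≤
          (2 * α + Cθ) * ϱ * ((1 + |correctorPhase k b v|) * (1 + collisionFrequency β v)) := by
        have h3 : (α * collisionFrequency β v + |fourierPhase k v|) * ϱ + α * (collisionFrequency β v * ϱ) ≤
            (2 * α + Cθ) * ϱ * collisionFrequency β v := by nlinarith [mul_nonneg hϱ ha]
        have h4 : collisionFrequency β v ≤ (1 + |correctorPhase k b v|) * (1 + collisionFrequency β v) := by
          nlinarith [mul_nonneg hP ha]
        have h5 : 0 ≤ (2 * α + Cθ) * ϱ := by positivity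
        exact h3.trans (mul_le_mul_of_nonneg_left h4 h5)
      linarith
    have hprod := mul_le_mul hA hB (by positivity) (by positivity)
    calc 2 * |⟪fibreRemainder β α b ρ₀ k x v, fibreRemainderDeriv β α b ρ₀ k x v⟫_ℝ| * maxwellianBeta β v
        ≤ 2 * ((g + ϱ) * (1 + |correctorPhase k b v|) *
            ((L * g + (2 * α + Cθ) * ϱ) * ((1 + |correctorPhase k b v|) * (1 + collisionFrequency β v)))) *
            maxwellianBeta β v := by gcongr; exact hin.trans hprod
      _ = C * ((1 + |correctorPhase k b v|) ^ 2 * (1 + collisionFrequency β v) * maxwellianBeta β v) := by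
          rw [hC]; ring
  · exact (integrable_energyMajorant hd hβ hb k).const_mul C
  · refine Eventually.of_forall fun v x hx => ?_
    have hx0 : 0 < x := by linarith [mem_Ioi.1 hx, ht]
    exact ((hasDerivAt_fibreRemainder h hd k hx0 v).norm_sq).mul_const (maxwellianBeta β v)

/-! ## The gain operator on the expansion; the source term -/

/-- `K 1 = a_β` (complex form). [folklore] -/
theorem carlemanGainC_one (hd : 2 ≤ Fintype.card d) (hβ : 0 < β) (v : 𝔼) :
    carlemanGainC β (fun _ => (1 : ℂ)) v = (collisionFrequency β v : ℂ) := by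
  have h := carlemanGainC_ofReal β (fun _ : 𝔼 => (1 : ℝ)) v
  simp only [Complex.ofReal_one] at h
  rw [h, carlemanGain]
  simp only [mul_one]
  rw [integral_carlemanKernel hd hβ v]

/-- `K (c g) = c K g`. [folklore] -/
theorem carlemanGainC_const_mul (β : ℝ) (c : ℂ) (g : 𝔼 → ℂ) (v : 𝔼) :
    carlemanGainC β (fun w => c * g w) v = c * carlemanGainC β g v := by
  rw [carlemanGainC, carlemanGainC, ← integral_const_mul]
  refine integral_congr_ae (Eventually.of_forall fun u => ?_)
  ring

/-- `K (f - g) = K f - K g` where both Carleman integrals converge. [folklore] -/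
theorem carlemanGainC_sub (β : ℝ) (f g : 𝔼 → ℂ) {v : 𝔼} (hf : Integrable fun u => (carlemanKernel β v u : ℂ) * f (v + u))
    (hg : Integrable fun u => (carlemanKernel β v u : ℂ) * g (v + u)) :
    carlemanGainC β (fun w => f w - g w) v = carlemanGainC β f v - carlemanGainC β g v := by
  rw [carlemanGainC, carlemanGainC, carlemanGainC, ← integral_sub hf hg]
  refine integral_congr_ae (Eventually.of_forall fun u => ?_)
  ring

/-- **`K` on the expansion**: `K Ψ(t) (v) = ρ̂⁰(k) e^{-λt/α} (a_β(v) - i α⁻¹ (K p)(v))` wherever the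
Carleman integral of `p` converges. [folklore] -/
theorem carlemanGainC_fibreExpansion (hd : 2 ≤ Fintype.card d) (hβ : 0 < β) (hb : IsDiffusionCorrector β b)
    (g₀ : ℂ) (t : ℝ) {v : 𝔼} (hv : Integrable fun u => carlemanKernel β v u * correctorPhase k b (v + u)) :
    carlemanGainC β (fibreExpansion β α b k g₀ t) v =
      g₀ * (Real.exp (-(heatRate β b k / α * t)) : ℂ) *
        ((collisionFrequency β v : ℂ) - I * ((α⁻¹ : ℝ) : ℂ) * (carlemanGain β (correctorPhase k b) v : ℂ)) := by
  set G : ℂ := g₀ * (Real.exp (-(heatRate β b k / α * t)) : ℂ) with hG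
  set f₁ : 𝔼 → ℂ := fun _ => (1 : ℂ) with hf₁
  set f₂ : 𝔼 → ℂ := fun w => I * ((α⁻¹ : ℝ) : ℂ) * (correctorPhase k b w : ℂ) with hf₂
  have hfun : fibreExpansion β α b k g₀ t = fun w => G * (f₁ w - f₂ w) := by
    funext w; rw [fibreExpansion, hG, hf₁, hf₂]; push_cast; ring
  have h1 : Integrable fun u => (carlemanKernel β v u : ℂ) * f₁ (v + u) :=
    integrable_carlemanKernel_mul_complex hd hβ (g := f₁) measurable_const (C := 1) (fun w => by simp [hf₁]) v
  have h2 : Integrable fun u => (carlemanKernel β v u : ℂ) * f₂ (v + u) := by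
    refine (hv.norm.const_mul |α⁻¹|).mono' ?_ (Eventually.of_forall fun u => ?_)
    · exact ((Complex.measurable_ofReal.comp (measurable_carlemanKernel_right β v)).mul
        ((measurable_const.mul (Complex.measurable_ofReal.comp (measurable_correctorPhase hb k))).comp
          (measurable_const_add v))).aestronglyMeasurable
    · rw [hf₂]
      simp only [norm_mul, Complex.norm_real, Complex.norm_I, Real.norm_eq_abs, one_mul]
      exact le_of_eq (by ring)
  rw [hfun, carlemanGainC_const_mul, carlemanGainC_sub β f₁ f₂ h1 h2, hf₁, hf₂, carlemanGainC_one hd hβ,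
    carlemanGainC_const_mul, carlemanGainC_ofReal]

/-- **The source term** `S = ρ̂⁰(k) e^{-λt/α} α⁻¹ ((θ_k p - λ) + i α⁻¹ λ p)` of the remainder equation.
[cite: BodineauGallagherSaintRaymondInvent2016, (6.9)] -/
def fibreSource (β α : ℝ) (b : 𝔼 → 𝔼) (ρ₀ : 𝕋 → ℝ) (k : d → ℤ) (t : ℝ) (v : 𝔼) : ℂ :=
  datumCoeff ρ₀ k * (Real.exp (-(heatRate β b k / α * t)) : ℂ) * ((α⁻¹ : ℝ) : ℂ) *
    (((fourierPhase k v * correctorPhase k b v - heatRate β b k : ℝ) : ℂ) +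
      ((α⁻¹ * heatRate β b k : ℝ) : ℂ) * I * (correctorPhase k b v : ℂ))

/-- **Algebra of the remainder equation.** For complex numbers `Ψ, R, KΨ, KR` and the data of the
fibred equation, if `R' = -L Ψ - (c (Ψ - R) + α (KΨ - KR))` with `c = -(α a + iθ)` then
`2 Re(R' R̄) = -2α ((a R₁² - R₁ Re KR) + (a R₂² - R₂ Im KR)) + 2 Re(S R̄)` with
`S = -L Ψ - c Ψ - α KΨ`. [folklore] -/
theorem two_mul_re_deriv_mul_conj (Ψ R KΨ KR : ℂ) (α a θ L : ℝ) :
    2 * ((-(L : ℂ) * Ψ - (-(((α * a : ℝ) : ℂ) + θ * I) * (Ψ - R) + (α : ℂ) * (KΨ - KR))) * (starRingEnd ℂ) R).re =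
      -2 * α * ((a * R.re ^ 2 - R.re * KR.re) + (a * R.im ^ 2 - R.im * KR.im)) +
        2 * ((-(L : ℂ) * Ψ - -(((α * a : ℝ) : ℂ) + θ * I) * Ψ - (α : ℂ) * KΨ) * (starRingEnd ℂ) R).re := by
  simp only [Complex.mul_re, Complex.sub_re, Complex.sub_im, Complex.add_re, Complex.add_im, Complex.neg_re,
    Complex.neg_im, Complex.mul_im, Complex.ofReal_re, Complex.ofReal_im, Complex.I_re, Complex.I_im,
    Complex.conj_re, Complex.conj_im]
  ring

/-- **The expansion solves the fibred equation up to the source**: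
`-(λ/α) Ψ - c Ψ - α K Ψ = S` given `a p - K p = θ` (with `Ψ = g e (1 - iα⁻¹p)`, `K Ψ = g e (a - iα⁻¹ K p)`).
[cite: BodineauGallagherSaintRaymondInvent2016, (6.6) and (6.9)] -/
theorem expansion_source_identity (g : ℂ) (e α a θ p Kp lam : ℝ) (hα : α ≠ 0) (hcorr : a * p - Kp = θ) :
    -(((lam / α : ℝ)) : ℂ) * (g * (e : ℂ) * (1 - I * ((α⁻¹ * p : ℝ) : ℂ))) -
        -(((α * a : ℝ) : ℂ) + θ * I) * (g * (e : ℂ) * (1 - I * ((α⁻¹ * p : ℝ) : ℂ))) -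
        (α : ℂ) * (g * (e : ℂ) * ((a : ℂ) - I * ((α⁻¹ : ℝ) : ℂ) * (Kp : ℂ))) =
      g * (e : ℂ) * ((α⁻¹ : ℝ) : ℂ) * (((θ * p - lam : ℝ) : ℂ) + ((α⁻¹ * lam : ℝ) : ℂ) * I * (p : ℂ)) := by
  have hKp : Kp = a * p - θ := by linarith
  subst hKp
  apply Complex.ext
  · simp only [Complex.mul_re, Complex.sub_re, Complex.sub_im, Complex.add_re, Complex.add_im, Complex.neg_re,
      Complex.neg_im, Complex.mul_im, Complex.ofReal_re, Complex.ofReal_im, Complex.I_re, Complex.I_im,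
      Complex.one_re, Complex.one_im]
    field_simp
    ring
  · simp only [Complex.mul_re, Complex.sub_re, Complex.sub_im, Complex.add_re, Complex.add_im, Complex.neg_re,
      Complex.neg_im, Complex.mul_im, Complex.ofReal_re, Complex.ofReal_im, Complex.I_re, Complex.I_im,
      Complex.one_re, Complex.one_im]
    field_simp
    ring

/-- The Carleman integrand of the expansion converges wherever that of `p` does. [folklore] -/
theorem integrable_carlemanKernel_mul_fibreExpansion (hd : 2 ≤ Fintype.card d) (hβ : 0 < β) (hb : IsDiffusionCorrector β b)
    (g₀ : ℂ) (t : ℝ) {v : 𝔼} (hv : Integrable fun u => carlemanKernel β v u * correctorPhase k b (v + u)) :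
    Integrable fun u => (carlemanKernel β v u : ℂ) * fibreExpansion β α b k g₀ t (v + u) := by
  set G : ℂ := g₀ * (Real.exp (-(heatRate β b k / α * t)) : ℂ) with hG
  have h1 : Integrable fun u => (carlemanKernel β v u : ℂ) * (1 : ℂ) :=
    integrable_carlemanKernel_mul_complex hd hβ (g := fun _ => (1 : ℂ)) measurable_const (C := 1) (fun w => by simp) v
  have h2 : Integrable fun u => (carlemanKernel β v u : ℂ) * (I * ((α⁻¹ : ℝ) : ℂ) * (correctorPhase k b (v + u) : ℂ)) := by
    refine (hv.norm.const_mul |α⁻¹|).mono' ?_ (Eventually.of_forall fun u => ?_)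
    · exact ((Complex.measurable_ofReal.comp (measurable_carlemanKernel_right β v)).mul
        ((measurable_const.mul (Complex.measurable_ofReal.comp (measurable_correctorPhase hb k))).comp
          (measurable_const_add v))).aestronglyMeasurable
    · simp only [norm_mul, Complex.norm_real, Complex.norm_I, Real.norm_eq_abs, one_mul]
      exact le_of_eq (by ring)
  refine ((h1.sub h2).const_mul G).congr (Eventually.of_forall fun u => ?_)
  simp only [Pi.sub_apply, fibreExpansion, ← hG]
  push_cast
  ring

/-- **The pointwise energy identity** (a.e. in `v`, at any time `t`):
`2 ⟪R, R'⟫ = -2α [(a R₁² - R₁ K R₁) + (a R₂² - R₂ K R₂)] + 2 ⟪R, S⟫`, `R = R₁ + i R₂`.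
[cite: BodineauGallagherSaintRaymondInvent2016, §6.1.3] -/
theorem ae_inner_fibreRemainderDeriv_eq (h : LinearBoltzmannData (Torus.geometry d) β α (fun x _ => ρ₀ x) ϱ)
    (hd : 2 ≤ Fintype.card d) (hb : IsDiffusionCorrector β b) (hα : 1 ≤ α) (k : d → ℤ) (t : ℝ) :
    ∀ᵐ v : 𝔼, 2 * ⟪fibreRemainder β α b ρ₀ k t v, fibreRemainderDeriv β α b ρ₀ k t v⟫_ℝ =
      -2 * α * ((collisionFrequency β v * (fibreRemainder β α b ρ₀ k t v).re ^ 2 -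
          (fibreRemainder β α b ρ₀ k t v).re * carlemanGain β (fun w => (fibreRemainder β α b ρ₀ k t w).re) v) +
        (collisionFrequency β v * (fibreRemainder β α b ρ₀ k t v).im ^ 2 -
          (fibreRemainder β α b ρ₀ k t v).im * carlemanGain β (fun w => (fibreRemainder β α b ρ₀ k t w).im) v)) +
      2 * ⟪fibreRemainder β α b ρ₀ k t v, fibreSource β α b ρ₀ k t v⟫_ℝ := by
  have hβ := h.beta_pos
  have hα0 : α ≠ 0 := by positivity
  have hp := finiteEnergy_correctorPhase hβ hb k
  have hintp : ∀ᵐ v : 𝔼, Integrable fun u => carlemanKernel β v u * correctorPhase k b (v + u) := by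
    have h1 := ae_integrable_carlemanKernel_mul hd hβ hp.measurable hp.integrable
    exact h1
  filter_upwards [ae_correctorPhase_eq hd hβ hb k, hintp] with v hcorr hv
  -- the objects at `v`
  set Ψ := fibreExpansion β α b k (datumCoeff ρ₀ k) t with hΨ
  set ψ := seriesFibre β α ρ₀ k t with hψ
  set R := fibreRemainder β α b ρ₀ k t with hR
  have hRdef : R = fun w => Ψ w - ψ w := rfl
  have hψR : ψ v = Ψ v - R v := by rw [hRdef]; ring
  -- Carleman integrals at `v`
  have hψint : Integrable fun u => (carlemanKernel β v u : ℂ) * ψ (v + u) :=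
    integrable_carlemanKernel_mul_complex hd hβ (g := ψ)
      ((continuous_seriesFibre h k).measurable.comp (measurable_const.prodMk measurable_id))
      (fun w => norm_seriesFibre_le h k t w) v
  have hΨint : Integrable fun u => (carlemanKernel β v u : ℂ) * Ψ (v + u) :=
    integrable_carlemanKernel_mul_fibreExpansion hd hβ hb _ t hv
  have hRint : Integrable fun u => (carlemanKernel β v u : ℂ) * R (v + u) :=
    (hΨint.sub hψint).congr (Eventually.of_forall fun u => by simp only [Pi.sub_apply, hRdef]; ring)
  have hKR : carlemanGainC β R v = carlemanGainC β Ψ v - carlemanGainC β ψ v := by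
    rw [hRdef]; exact carlemanGainC_sub β Ψ ψ hΨint hψint
  have hKψ : carlemanGainC β ψ v = carlemanGainC β Ψ v - carlemanGainC β R v := by rw [hKR]; ring
  have hKRre : (carlemanGainC β R v).re = carlemanGain β (fun w => (R w).re) v := re_carlemanGainC hRint
  have hKRim : (carlemanGainC β R v).im = carlemanGain β (fun w => (R w).im) v := im_carlemanGainC hRint
  have hKΨ := carlemanGainC_fibreExpansion (α := α) hd hβ hb (datumCoeff ρ₀ k) t hv
  rw [← hΨ] at hKΨ
  -- the derivative in the abstract form
  have hderiv : fibreRemainderDeriv β α b ρ₀ k t v =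
      -(((heatRate β b k / α : ℝ)) : ℂ) * Ψ v -
        (-(((α * collisionFrequency β v : ℝ) : ℂ) + fourierPhase k v * I) * (Ψ v - R v) +
          (α : ℂ) * (carlemanGainC β Ψ v - carlemanGainC β R v)) := by
    rw [fibreRemainderDeriv, ← hψ, ← hΨ, hKψ, hψR]
  -- the source
  have hS : -(((heatRate β b k / α : ℝ)) : ℂ) * Ψ v -
      -(((α * collisionFrequency β v : ℝ) : ℂ) + fourierPhase k v * I) * Ψ v - (α : ℂ) * carlemanGainC β Ψ v =
      fibreSource β α b ρ₀ k t v := by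
    rw [hKΨ, hΨ, fibreExpansion, fibreSource]
    exact expansion_source_identity (datumCoeff ρ₀ k) _ α (collisionFrequency β v) (fourierPhase k v)
      (correctorPhase k b v) _ (heatRate β b k) hα0 hcorr
  rw [Complex.inner, Complex.inner, hderiv, two_mul_re_deriv_mul_conj, hKRre, hKRim, hS]

/-! ## Integration: Dirichlet forms, the source, and the differential inequality -/

/-- The constant `N₀² = ∫ S₀² / a_β M_β`, `S₀ = θ_k p - λ` (finite: `θ_k² ≤ C a_β²`, `p` of finite energy).
[folklore] -/
def sourceNormSq (β : ℝ) (b : 𝔼 → 𝔼) (k : d → ℤ) : ℝ :=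
  ∫ v, (fourierPhase k v * correctorPhase k b v - heatRate β b k) ^ 2 / collisionFrequency β v * maxwellianBeta β v

/-- The constant `P² = ∫ p² M_β`. [folklore] -/
def correctorPhaseNormSq (β : ℝ) (b : 𝔼 → 𝔼) (k : d → ℤ) : ℝ :=
  ∫ v, correctorPhase k b v ^ 2 * maxwellianBeta β v

/-- `h (K g) M_β` is integrable for `g, h` of finite energy (Fubini on the Carleman form). [folklore] -/
theorem integrable_mul_carlemanGain_mul_maxwellianBeta (hd : 2 ≤ Fintype.card d) (hβ : 0 < β) {g f : 𝔼 → ℝ}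
    (hg : FiniteEnergy β g) (hf : FiniteEnergy β f) :
    Integrable fun v => f v * carlemanGain β g v * maxwellianBeta β v := by
  have h1 := (integrable_weight_mul_mul hd hβ hg.measurable hg.integrable hf.measurable hf.integrable).integral_prod_left
  refine h1.congr (Eventually.of_forall fun v => ?_)
  simp only
  rw [carlemanGain, ← integral_const_mul, ← integral_mul_const]
  congr 1
  funext u
  ring

/-- `∫ (a g² - g K g) M_β = B(g, g)` for `g` of finite energy. [folklore] -/
theorem integral_sub_mul_carlemanGain_eq_dirichletForm (hd : 2 ≤ Fintype.card d) (hβ : 0 < β) {g : 𝔼 → ℝ}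
    (hg : FiniteEnergy β g) :
    ∫ v, (collisionFrequency β v * g v ^ 2 - g v * carlemanGain β g v) * maxwellianBeta β v = dirichletForm β g g := by
  have h1 : Integrable fun v => collisionFrequency β v * g v ^ 2 * maxwellianBeta β v :=
    hg.integrable.congr (Eventually.of_forall fun v => by ring)
  have h2 := integrable_mul_carlemanGain_mul_maxwellianBeta hd hβ hg hg
  simp_rw [sub_mul]
  rw [integral_sub h1 h2, dirichletForm, carlemanForm_eq_integral_carlemanGain hd hβ hg.measurable hg.integrable
    hg.measurable hg.integrable]
  congr 1
  · exact integral_congr_ae (Eventually.of_forall fun v => by ring)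
  · exact integral_congr_ae (Eventually.of_forall fun v => by ring)

/-- **The source has `M_β`-mean zero**: `∫ (θ_k p - λ) M_β = λ - λ = 0`.
[cite: BodineauGallagherSaintRaymondInvent2016, (6.6)] -/
theorem integral_source₀_mul_maxwellianBeta (hd : 2 ≤ Fintype.card d) (hβ : 0 < β) (hb : IsDiffusionCorrector β b)
    (k : d → ℤ) : ∫ v, (fourierPhase k v * correctorPhase k b v - heatRate β b k) * maxwellianBeta β v = 0 := by
  obtain ⟨Cθ, hCθ0, hCθ⟩ := exists_abs_fourierPhase_le_mul_collisionFrequency hd hβ k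
  have hp := finiteEnergy_correctorPhase hβ hb k
  have h1 : Integrable fun v => fourierPhase k v * correctorPhase k b v * maxwellianBeta β v := by
    refine ((hp.integrable.add (integrable_collisionFrequency_mul_maxwellianBeta hβ)).const_mul Cθ).mono'
      ((((continuous_fourierPhase k).measurable.mul hp.measurable).mul
        (KineticTheory.measurable_maxwellianBeta β)).aestronglyMeasurable) (Eventually.of_forall fun v => ?_)
    have hM := (maxwellianBeta_pos hβ v).le
    have ha := TaggedLinearBoltzmannSeries.collisionFrequency_nonneg hβ v
    rw [Real.norm_eq_abs, abs_mul, abs_mul, abs_of_nonneg hM]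
    simp only [Pi.add_apply]
    have h2 : |correctorPhase k b v| * 1 ≤ (correctorPhase k b v ^ 2 + 1) := by
      nlinarith [sq_nonneg (|correctorPhase k b v| - 1), sq_abs (correctorPhase k b v)]
    calc |fourierPhase k v| * |correctorPhase k b v| * maxwellianBeta β v
        ≤ Cθ * collisionFrequency β v * |correctorPhase k b v| * maxwellianBeta β v := by gcongr; exact hCθ v
      _ ≤ Cθ * collisionFrequency β v * (correctorPhase k b v ^ 2 + 1) * maxwellianBeta β v := by
          have h3 : 0 ≤ Cθ * collisionFrequency β v := mul_nonneg hCθ0 ha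
          have h4 : |correctorPhase k b v| ≤ correctorPhase k b v ^ 2 + 1 := by linarith
          exact mul_le_mul_of_nonneg_right (mul_le_mul_of_nonneg_left h4 h3) hM
      _ = Cθ * (correctorPhase k b v ^ 2 * collisionFrequency β v * maxwellianBeta β v +
            collisionFrequency β v * maxwellianBeta β v) := by ring
  simp_rw [sub_mul]
  rw [integral_sub h1 ((KineticTheory.integrable_maxwellianBeta hβ).const_mul _), integral_const_mul,
    KineticTheory.integral_maxwellianBeta hβ, integral_fourierPhase_mul_correctorPhase hd hβ hb k]
  ring

/-- Finite energy of the real and imaginary parts of the remainder (`t ≥ 0`). [folklore] -/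
theorem finiteEnergy_reIm_fibreRemainder (h : LinearBoltzmannData (Torus.geometry d) β α (fun x _ => ρ₀ x) ϱ)
    (hd : 2 ≤ Fintype.card d) (hb : IsDiffusionCorrector β b) (hα : 1 ≤ α) (k : d → ℤ) {t : ℝ} (ht : 0 ≤ t) :
    FiniteEnergy β (fun v => (fibreRemainder β α b ρ₀ k t v).re) ∧
      FiniteEnergy β (fun v => (fibreRemainder β α b ρ₀ k t v).im) := by
  haveI : Nonempty d := Fintype.card_pos_iff.1 (by omega)
  have hβ := h.beta_pos
  have hϱ := h.bound_nonneg
  set g := ‖datumCoeff ρ₀ k‖ with hg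
  have hRm := measurable_fibreRemainder h hb k t
  -- `|R_j|² a M ≤ |R|² a M ≤ 2 (g² + ϱ²) W`
  have hdom : ∀ f : ℂ → ℝ, (∀ z, |f z| ≤ ‖z‖) → Measurable f →
      Integrable fun v => f (fibreRemainder β α b ρ₀ k t v) ^ 2 * collisionFrequency β v * maxwellianBeta β v := by
    intro f hf hfm
    refine integrable_of_le_energyMajorant hd hβ hb k (((hfm.comp hRm).pow_const 2).mul
      (continuous_collisionFrequency hβ).measurable |>.mul (KineticTheory.measurable_maxwellianBeta β))
      (2 * (g ^ 2 + ϱ ^ 2)) fun v => ?_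
    have hM := (maxwellianBeta_pos hβ v).le
    have ha := TaggedLinearBoltzmannSeries.collisionFrequency_nonneg hβ v
    have hP : 0 ≤ |correctorPhase k b v| := abs_nonneg _
    have hR := norm_fibreRemainder_le h hd hb hα k ht v
    have h1 : f (fibreRemainder β α b ρ₀ k t v) ^ 2 ≤ ‖fibreRemainder β α b ρ₀ k t v‖ ^ 2 := by
      rw [← sq_abs]; exact pow_le_pow_left₀ (abs_nonneg _) (hf _) 2
    rw [Real.norm_of_nonneg (mul_nonneg (mul_nonneg (sq_nonneg _) ha) hM), energyMajorant]
    have h2 : ‖fibreRemainder β α b ρ₀ k t v‖ ^ 2 ≤ 2 * (g ^ 2 + ϱ ^ 2) * (1 + |correctorPhase k b v|) ^ 2 := by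
      calc ‖fibreRemainder β α b ρ₀ k t v‖ ^ 2 ≤ (g * (1 + |correctorPhase k b v|) + ϱ) ^ 2 := by gcongr
        _ ≤ 2 * (g ^ 2 + ϱ ^ 2) * (1 + |correctorPhase k b v|) ^ 2 := by
            nlinarith [sq_nonneg (g * (1 + |correctorPhase k b v|) - ϱ), mul_nonneg hϱ hP, sq_nonneg ϱ,
              mul_nonneg (sq_nonneg ϱ) hP, mul_nonneg (mul_nonneg (sq_nonneg ϱ) hP) hP]
    calc f (fibreRemainder β α b ρ₀ k t v) ^ 2 * collisionFrequency β v * maxwellianBeta β v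
        ≤ 2 * (g ^ 2 + ϱ ^ 2) * (1 + |correctorPhase k b v|) ^ 2 * collisionFrequency β v * maxwellianBeta β v := by
          gcongr; exact h1.trans h2
      _ ≤ 2 * (g ^ 2 + ϱ ^ 2) * (1 + |correctorPhase k b v|) ^ 2 * (1 + collisionFrequency β v) * maxwellianBeta β v := by
          gcongr; linarith
      _ = _ := by ring
  exact ⟨⟨Complex.measurable_re.comp hRm, hdom _ (fun z => Complex.abs_re_le_norm z) Complex.measurable_re⟩,
    ⟨Complex.measurable_im.comp hRm, hdom _ (fun z => Complex.abs_im_le_norm z) Complex.measurable_im⟩⟩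

/-- Young's inequality `2 x y ≤ η x² + y² / η`. [folklore] -/
theorem two_mul_le_of_young {x y η : ℝ} (hη : 0 < η) : 2 * x * y ≤ η * x ^ 2 + y ^ 2 / η := by
  have h : 0 ≤ (η * x - y) ^ 2 / η := div_nonneg (sq_nonneg _) hη.le
  have h2 : (η * x - y) ^ 2 / η = η * x ^ 2 - 2 * x * y + y ^ 2 / η := by
    field_simp
    ring
  linarith

/-- **Pointwise bound on the source pairing** (complex bookkeeping + Young): for
`S = G (S₀ + i a⁻ λ p)` and any constant `m`,
`2 Re(S R̄) ≤ η |R - m|² + (|G| |S₀|)²/η + 2 S₀ Re(G m̄) + |G| a⁻ (|R|² + λ² p²)`. [folklore] -/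
theorem source_pairing_le (G R m : ℂ) (S₀ p lam ainv η : ℝ) (hη : 0 < η) (hlam : 0 ≤ lam) (hainv : 0 ≤ ainv) :
    2 * ((G * ((S₀ : ℂ) + ((ainv * lam : ℝ) : ℂ) * I * (p : ℂ))) * (starRingEnd ℂ) R).re ≤
      η * ‖R - m‖ ^ 2 + (‖G‖ * |S₀|) ^ 2 / η + 2 * S₀ * (G * (starRingEnd ℂ) m).re +
        ‖G‖ * ainv * (‖R‖ ^ 2 + lam ^ 2 * p ^ 2) := by
  -- split the pairing
  have hsplit : (G * ((S₀ : ℂ) + ((ainv * lam : ℝ) : ℂ) * I * (p : ℂ))) * (starRingEnd ℂ) R =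
      G * (S₀ : ℂ) * (starRingEnd ℂ) (R - m) + G * (S₀ : ℂ) * (starRingEnd ℂ) m +
        G * (((ainv * lam : ℝ) : ℂ) * I * (p : ℂ)) * (starRingEnd ℂ) R := by
    rw [map_sub]; ring
  rw [hsplit, Complex.add_re, Complex.add_re]
  -- term 1: Young
  have h1 : 2 * (G * (S₀ : ℂ) * (starRingEnd ℂ) (R - m)).re ≤ η * ‖R - m‖ ^ 2 + (‖G‖ * |S₀|) ^ 2 / η := by
    have hle : (G * (S₀ : ℂ) * (starRingEnd ℂ) (R - m)).re ≤ ‖R - m‖ * (‖G‖ * |S₀|) := by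
      refine (Complex.re_le_norm _).trans (le_of_eq ?_)
      rw [norm_mul, norm_mul, Complex.norm_real, Real.norm_eq_abs, Complex.norm_conj]; ring
    have hy := two_mul_le_of_young (x := ‖R - m‖) (y := ‖G‖ * |S₀|) hη
    linarith
  -- term 2: exact (`S₀` real)
  have h2 : (G * (S₀ : ℂ) * (starRingEnd ℂ) m).re = S₀ * (G * (starRingEnd ℂ) m).re := by
    have : G * (S₀ : ℂ) * (starRingEnd ℂ) m = (S₀ : ℂ) * (G * (starRingEnd ℂ) m) := by ring
    rw [this, Complex.re_ofReal_mul]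
  -- term 3: `2|R| λ|p| ≤ |R|² + λ²p²`
  have h3 : 2 * (G * (((ainv * lam : ℝ) : ℂ) * I * (p : ℂ)) * (starRingEnd ℂ) R).re ≤
      ‖G‖ * ainv * (‖R‖ ^ 2 + lam ^ 2 * p ^ 2) := by
    have hle : (G * (((ainv * lam : ℝ) : ℂ) * I * (p : ℂ)) * (starRingEnd ℂ) R).re ≤ ‖G‖ * ainv * (lam * |p| * ‖R‖) := by
      refine (Complex.re_le_norm _).trans (le_of_eq ?_)
      rw [norm_mul, norm_mul, norm_mul, norm_mul, Complex.norm_real, Complex.norm_real, Complex.norm_I,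
        Real.norm_eq_abs, Real.norm_eq_abs, Complex.norm_conj, abs_mul, abs_of_nonneg hainv, abs_of_nonneg hlam]
      ring
    have hy : 2 * (lam * |p| * ‖R‖) ≤ ‖R‖ ^ 2 + lam ^ 2 * p ^ 2 := by
      nlinarith [sq_nonneg (lam * |p| - ‖R‖), sq_abs p]
    have hG : 0 ≤ ‖G‖ * ainv := mul_nonneg (norm_nonneg _) hainv
    nlinarith
  linarith

/-- `y'(t) = ∫ 2 ⟪R, R'⟫ M_β` for `t > 0`. [folklore] -/
theorem hasDerivAt_fibreEnergy (h : LinearBoltzmannData (Torus.geometry d) β α (fun x _ => ρ₀ x) ϱ)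
    (hd : 2 ≤ Fintype.card d) (hb : IsDiffusionCorrector β b) (hα : 1 ≤ α) (k : d → ℤ) {t : ℝ} (ht : 0 < t) :
    HasDerivAt (fibreEnergy β α b ρ₀ k)
      (∫ v, 2 * ⟪fibreRemainder β α b ρ₀ k t v, fibreRemainderDeriv β α b ρ₀ k t v⟫_ℝ * maxwellianBeta β v) t :=
  (integrable_and_hasDerivAt_fibreEnergy h hd hb hα k ht).2

/-- `S₀ M_β` is integrable. [folklore] -/
theorem integrable_source₀_mul_maxwellianBeta (hd : 2 ≤ Fintype.card d) (hβ : 0 < β) (hb : IsDiffusionCorrector β b)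
    (k : d → ℤ) : Integrable fun v => (fourierPhase k v * correctorPhase k b v - heatRate β b k) * maxwellianBeta β v := by
  obtain ⟨Cθ, hCθ0, hCθ⟩ := exists_abs_fourierPhase_le_mul_collisionFrequency hd hβ k
  refine integrable_of_le_energyMajorant hd hβ hb k ((((continuous_fourierPhase k).measurable.mul
    (measurable_correctorPhase hb k)).sub measurable_const).mul (KineticTheory.measurable_maxwellianBeta β))
    (Cθ + |heatRate β b k|) fun v => ?_
  have hM := (maxwellianBeta_pos hβ v).le
  have ha := TaggedLinearBoltzmannSeries.collisionFrequency_nonneg hβ v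
  have hP : 0 ≤ |correctorPhase k b v| := abs_nonneg _
  rw [Real.norm_eq_abs, abs_mul, abs_of_nonneg hM, energyMajorant]
  have h1 : |fourierPhase k v * correctorPhase k b v - heatRate β b k| ≤
      Cθ * collisionFrequency β v * |correctorPhase k b v| + |heatRate β b k| := by
    calc |fourierPhase k v * correctorPhase k b v - heatRate β b k|
        ≤ |fourierPhase k v * correctorPhase k b v| + |heatRate β b k| := abs_sub _ _
      _ ≤ Cθ * collisionFrequency β v * |correctorPhase k b v| + |heatRate β b k| := by
          rw [abs_mul]; gcongr; exact hCθ v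
  have h2 : Cθ * collisionFrequency β v * |correctorPhase k b v| + |heatRate β b k| ≤
      (Cθ + |heatRate β b k|) * ((1 + |correctorPhase k b v|) ^ 2 * (1 + collisionFrequency β v)) := by
    have h3 : collisionFrequency β v * |correctorPhase k b v| ≤ (1 + |correctorPhase k b v|) ^ 2 * (1 + collisionFrequency β v) := by
      nlinarith [mul_nonneg hP ha, mul_nonneg (mul_nonneg hP hP) ha, sq_nonneg (correctorPhase k b v)]
    have h4 : (1 : ℝ) ≤ (1 + |correctorPhase k b v|) ^ 2 * (1 + collisionFrequency β v) := by
      nlinarith [mul_nonneg hP ha]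
    nlinarith [mul_le_mul_of_nonneg_left h3 hCθ0, mul_le_mul_of_nonneg_left h4 (abs_nonneg (heatRate β b k))]
  calc |fourierPhase k v * correctorPhase k b v - heatRate β b k| * maxwellianBeta β v
      ≤ (Cθ + |heatRate β b k|) * ((1 + |correctorPhase k b v|) ^ 2 * (1 + collisionFrequency β v)) * maxwellianBeta β v :=
        mul_le_mul_of_nonneg_right (h1.trans h2) hM
    _ = _ := by ring

/-- `S₀² / a_β M_β` is integrable. [folklore] -/
theorem integrable_source₀_sq_div_mul_maxwellianBeta (hd : 2 ≤ Fintype.card d) (hβ : 0 < β) (hb : IsDiffusionCorrector β b)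
    (k : d → ℤ) :
    Integrable fun v => (fourierPhase k v * correctorPhase k b v - heatRate β b k) ^ 2 / collisionFrequency β v * maxwellianBeta β v := by
  obtain ⟨a₀, ha₀, c, hc, hlow⟩ := exists_collisionFrequency_lowerBound (d := d) hd hβ
  obtain ⟨Cθ, hCθ0, hCθ⟩ := exists_abs_fourierPhase_le_mul_collisionFrequency hd hβ k
  refine integrable_of_le_energyMajorant hd hβ hb k (((((continuous_fourierPhase k).measurable.mul
    (measurable_correctorPhase hb k)).sub measurable_const).pow_const 2 |>.div
      (continuous_collisionFrequency hβ).measurable).mul (KineticTheory.measurable_maxwellianBeta β))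
    (2 * Cθ ^ 2 + 2 * heatRate β b k ^ 2 / a₀) fun v => ?_
  have hM := (maxwellianBeta_pos hβ v).le
  have ha : a₀ ≤ collisionFrequency β v := (hlow v).1
  have hapos : 0 < collisionFrequency β v := ha₀.trans_le ha
  have hP : 0 ≤ |correctorPhase k b v| := abs_nonneg _
  rw [Real.norm_of_nonneg (mul_nonneg (div_nonneg (sq_nonneg _) hapos.le) hM), energyMajorant, ← mul_assoc]
  refine mul_le_mul_of_nonneg_right ?_ hM
  rw [div_le_iff₀ hapos]
  have hθ := hCθ v
  have h1 : (fourierPhase k v * correctorPhase k b v - heatRate β b k) ^ 2 ≤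
      2 * (Cθ * collisionFrequency β v) ^ 2 * correctorPhase k b v ^ 2 + 2 * heatRate β b k ^ 2 := by
    have h2 : (fourierPhase k v * correctorPhase k b v) ^ 2 ≤ (Cθ * collisionFrequency β v) ^ 2 * correctorPhase k b v ^ 2 := by
      rw [mul_pow]
      refine mul_le_mul_of_nonneg_right ?_ (sq_nonneg _)
      calc fourierPhase k v ^ 2 = |fourierPhase k v| ^ 2 := (sq_abs _).symm
        _ ≤ (Cθ * collisionFrequency β v) ^ 2 := pow_le_pow_left₀ (abs_nonneg _) hθ 2
    nlinarith [sq_nonneg (fourierPhase k v * correctorPhase k b v + heatRate β b k)]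
  have h3 : 2 * (Cθ * collisionFrequency β v) ^ 2 * correctorPhase k b v ^ 2 ≤
      2 * Cθ ^ 2 * ((1 + |correctorPhase k b v|) ^ 2 * (1 + collisionFrequency β v)) * collisionFrequency β v := by
    have h4 : correctorPhase k b v ^ 2 ≤ (1 + |correctorPhase k b v|) ^ 2 := by
      rw [← sq_abs (correctorPhase k b v)]; gcongr; linarith
    have h5 : collisionFrequency β v ^ 2 ≤ (1 + collisionFrequency β v) * collisionFrequency β v := by nlinarith
    calc 2 * (Cθ * collisionFrequency β v) ^ 2 * correctorPhase k b v ^ 2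
        = 2 * Cθ ^ 2 * (correctorPhase k b v ^ 2 * collisionFrequency β v ^ 2) := by ring
      _ ≤ 2 * Cθ ^ 2 * ((1 + |correctorPhase k b v|) ^ 2 * ((1 + collisionFrequency β v) * collisionFrequency β v)) := by
          gcongr
      _ = _ := by ring
  have h6 : 2 * heatRate β b k ^ 2 ≤
      2 * heatRate β b k ^ 2 / a₀ * ((1 + |correctorPhase k b v|) ^ 2 * (1 + collisionFrequency β v)) * collisionFrequency β v := by
    have h7 : a₀ ≤ ((1 + |correctorPhase k b v|) ^ 2 * (1 + collisionFrequency β v)) * collisionFrequency β v := by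
      have : (1 : ℝ) ≤ (1 + |correctorPhase k b v|) ^ 2 * (1 + collisionFrequency β v) := by nlinarith [mul_nonneg hP hapos.le]
      nlinarith
    have h8 : 0 ≤ 2 * heatRate β b k ^ 2 / a₀ := by positivity
    calc 2 * heatRate β b k ^ 2 = 2 * heatRate β b k ^ 2 / a₀ * a₀ := by field_simp
      _ ≤ 2 * heatRate β b k ^ 2 / a₀ * (((1 + |correctorPhase k b v|) ^ 2 * (1 + collisionFrequency β v)) * collisionFrequency β v) :=
          mul_le_mul_of_nonneg_left h7 h8
      _ = _ := by ring
  calc (fourierPhase k v * correctorPhase k b v - heatRate β b k) ^ 2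
      ≤ 2 * (Cθ * collisionFrequency β v) ^ 2 * correctorPhase k b v ^ 2 + 2 * heatRate β b k ^ 2 := h1
    _ ≤ _ := by linarith

/-- `N₀² ≥ 0`. [folklore] -/
theorem sourceNormSq_nonneg (hβ : 0 < β) (b : 𝔼 → 𝔼) (k : d → ℤ) : 0 ≤ sourceNormSq β b k :=
  integral_nonneg fun v => mul_nonneg (div_nonneg (sq_nonneg _) (TaggedLinearBoltzmannSeries.collisionFrequency_nonneg hβ v))
    (maxwellianBeta_pos hβ v).le

/-- `P² ≥ 0`. [folklore] -/
theorem correctorPhaseNormSq_nonneg (hβ : 0 < β) (b : 𝔼 → 𝔼) (k : d → ℤ) : 0 ≤ correctorPhaseNormSq β b k :=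
  integral_nonneg fun v => mul_nonneg (sq_nonneg _) (maxwellianBeta_pos hβ v).le

/-- `y ≥ 0`. [folklore] -/
theorem fibreEnergy_nonneg (hβ : 0 < β) (b : 𝔼 → 𝔼) (ρ₀ : 𝕋 → ℝ) (k : d → ℤ) (t : ℝ) : 0 ≤ fibreEnergy β α b ρ₀ k t :=
  integral_nonneg fun v => mul_nonneg (sq_nonneg _) (maxwellianBeta_pos hβ v).le

/-- **The differential inequality** `y'(t) ≤ A + B y(t)` for `t > 0`, `α ≥ 1`, with
`A = |ρ̂⁰(k)|² N₀² / (2 c₀ α³) + |ρ̂⁰(k)| λ² P² / α²` and `B = |ρ̂⁰(k)| / α²`, `c₀` a spectral-gap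
constant of `L`. [cite: BodineauGallagherSaintRaymondInvent2016, §6.1.3] -/
theorem fibreEnergy_deriv_le (h : LinearBoltzmannData (Torus.geometry d) β α (fun x _ => ρ₀ x) ϱ)
    (hd : 2 ≤ Fintype.card d) (hb : IsDiffusionCorrector β b) (hα : 1 ≤ α) (k : d → ℤ) {c₀ : ℝ} (hc₀ : 0 < c₀)
    (hgap : ∀ g : 𝔼 → ℝ, FiniteEnergy β g →
      c₀ * ∫ v, (g v - energyMean β g) ^ 2 * (collisionFrequency β v * maxwellianBeta β v) ≤ dirichletForm β g g)
    {t : ℝ} (ht : 0 < t) :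
    ∫ v, 2 * ⟪fibreRemainder β α b ρ₀ k t v, fibreRemainderDeriv β α b ρ₀ k t v⟫_ℝ * maxwellianBeta β v ≤
      ‖datumCoeff ρ₀ k‖ ^ 2 * sourceNormSq β b k / (2 * c₀ * α ^ 3) +
        ‖datumCoeff ρ₀ k‖ * heatRate β b k ^ 2 * correctorPhaseNormSq β b k / α ^ 2 +
        ‖datumCoeff ρ₀ k‖ / α ^ 2 * fibreEnergy β α b ρ₀ k t := by
  haveI : Nonempty d := Fintype.card_pos_iff.1 (by omega)
  have hβ := h.beta_pos
  have hα0 : 0 < α := by linarith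
  obtain ⟨a₀, ha₀, c, hc, hlow⟩ := exists_collisionFrequency_lowerBound (d := d) hd hβ
  have hapos : ∀ v : 𝔼, 0 < collisionFrequency β v := fun v => ha₀.trans_le (hlow v).1
  have hp := finiteEnergy_correctorPhase hβ hb k
  set g := ‖datumCoeff ρ₀ k‖ with hg
  set lam := heatRate β b k with hlam
  have hlam0 : 0 ≤ lam := heatRate_nonneg hd hβ hb k
  set e := Real.exp (-(lam / α * t)) with he
  have he1 : e ≤ 1 := exp_heatRate_le_one (div_nonneg hlam0 hα0.le) ht.le
  have he0 : 0 < e := Real.exp_pos _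
  set G : ℂ := datumCoeff ρ₀ k * (e : ℂ) * ((α⁻¹ : ℝ) : ℂ) with hG
  have hGnorm : ‖G‖ = g * e * α⁻¹ := by
    rw [hG, norm_mul, norm_mul, Complex.norm_real, Complex.norm_real, Real.norm_of_nonneg he0.le,
      Real.norm_of_nonneg (inv_pos.2 hα0).le]
  have hGle : ‖G‖ ≤ g * α⁻¹ := by
    rw [hGnorm]
    calc g * e * α⁻¹ ≤ g * 1 * α⁻¹ := by gcongr
      _ = g * α⁻¹ := by rw [mul_one]
  -- the remainder and its parts at time `t`
  set R := fibreRemainder β α b ρ₀ k t with hR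
  obtain ⟨hfe₁, hfe₂⟩ := finiteEnergy_reIm_fibreRemainder h hd hb hα k ht.le
  rw [← hR] at hfe₁ hfe₂
  set m₁ := energyMean β (fun v => (R v).re) with hm₁
  set m₂ := energyMean β (fun v => (R v).im) with hm₂
  set m : ℂ := (m₁ : ℂ) + (m₂ : ℂ) * I with hm
  have hm_re : m.re = m₁ := by simp [hm]
  have hm_im : m.im = m₂ := by simp [hm]
  -- the source at time `t`
  have hS : ∀ v, fibreSource β α b ρ₀ k t v =
      G * (((fourierPhase k v * correctorPhase k b v - lam : ℝ)) + ((α⁻¹ * lam : ℝ) : ℂ) * I * (correctorPhase k b v : ℂ)) :=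
    fun v => by rw [fibreSource, hG]
  -- Step 1: the pointwise a.e. inequality
  have hpt : ∀ᵐ v : 𝔼, 2 * ⟪R v, fibreRemainderDeriv β α b ρ₀ k t v⟫_ℝ * maxwellianBeta β v ≤
      (-2 * α) * ((collisionFrequency β v * (R v).re ^ 2 - (R v).re * carlemanGain β (fun w => (R w).re) v) * maxwellianBeta β v +
          (collisionFrequency β v * (R v).im ^ 2 - (R v).im * carlemanGain β (fun w => (R w).im) v) * maxwellianBeta β v) +
        ((2 * α * c₀) * ((((R v).re - m₁) ^ 2 + ((R v).im - m₂) ^ 2) * (collisionFrequency β v * maxwellianBeta β v)) +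
          ‖G‖ ^ 2 / (2 * α * c₀) *
            ((fourierPhase k v * correctorPhase k b v - lam) ^ 2 / collisionFrequency β v * maxwellianBeta β v) +
          (2 * (G * (starRingEnd ℂ) m).re) * ((fourierPhase k v * correctorPhase k b v - lam) * maxwellianBeta β v) +
          ‖G‖ * α⁻¹ * (‖R v‖ ^ 2 * maxwellianBeta β v) +
          ‖G‖ * α⁻¹ * lam ^ 2 * (correctorPhase k b v ^ 2 * maxwellianBeta β v)) := by
    filter_upwards [ae_inner_fibreRemainderDeriv_eq h hd hb hα k t] with v hv
    rw [← hR] at hv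
    have hM := (maxwellianBeta_pos hβ v).le
    have ha := hapos v
    have hη : 0 < 2 * α * c₀ * collisionFrequency β v := by positivity
    have hsrc := source_pairing_le G (R v) m (fourierPhase k v * correctorPhase k b v - lam) (correctorPhase k b v) lam α⁻¹
      (2 * α * c₀ * collisionFrequency β v) hη hlam0 (inv_pos.2 hα0).le
    rw [← hS v, ← Complex.inner] at hsrc
    have hnormsq : ‖R v - m‖ ^ 2 = ((R v).re - m₁) ^ 2 + ((R v).im - m₂) ^ 2 := by
      rw [Complex.sq_norm, Complex.normSq_apply, Complex.sub_re, Complex.sub_im, hm_re, hm_im]; ring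
    rw [hv, add_mul]
    refine add_le_add (le_of_eq (by ring)) ?_
    calc 2 * ⟪R v, fibreSource β α b ρ₀ k t v⟫_ℝ * maxwellianBeta β v
        ≤ (2 * α * c₀ * collisionFrequency β v * ‖R v - m‖ ^ 2 +
            (‖G‖ * |fourierPhase k v * correctorPhase k b v - lam|) ^ 2 / (2 * α * c₀ * collisionFrequency β v) +
            2 * (fourierPhase k v * correctorPhase k b v - lam) * (G * (starRingEnd ℂ) m).re +
            ‖G‖ * α⁻¹ * (‖R v‖ ^ 2 + lam ^ 2 * correctorPhase k b v ^ 2)) * maxwellianBeta β v :=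
          mul_le_mul_of_nonneg_right hsrc hM
      _ = _ := by
          rw [hnormsq, mul_pow, sq_abs]
          field_simp
          ring
  -- Step 2: integrability of all the pieces (as explicit lambdas)
  have hLint := (integrable_and_hasDerivAt_fibreEnergy h hd hb hα k ht).1
  rw [← hR] at hLint
  have hd₁ : Integrable fun v => (collisionFrequency β v * (R v).re ^ 2 - (R v).re * carlemanGain β (fun w => (R w).re) v) *
      maxwellianBeta β v := by
    have h1 : Integrable fun v => collisionFrequency β v * (R v).re ^ 2 * maxwellianBeta β v :=
      hfe₁.integrable.congr (Eventually.of_forall fun v => by ring)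
    have h2 : Integrable fun v => collisionFrequency β v * (R v).re ^ 2 * maxwellianBeta β v -
        (R v).re * carlemanGain β (fun w => (R w).re) v * maxwellianBeta β v :=
      h1.sub (integrable_mul_carlemanGain_mul_maxwellianBeta hd hβ hfe₁ hfe₁)
    exact h2.congr (Eventually.of_forall fun v => by ring)
  have hd₂ : Integrable fun v => (collisionFrequency β v * (R v).im ^ 2 - (R v).im * carlemanGain β (fun w => (R w).im) v) *
      maxwellianBeta β v := by
    have h1 : Integrable fun v => collisionFrequency β v * (R v).im ^ 2 * maxwellianBeta β v :=
      hfe₂.integrable.congr (Eventually.of_forall fun v => by ring)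
    have h2 : Integrable fun v => collisionFrequency β v * (R v).im ^ 2 * maxwellianBeta β v -
        (R v).im * carlemanGain β (fun w => (R w).im) v * maxwellianBeta β v :=
      h1.sub (integrable_mul_carlemanGain_mul_maxwellianBeta hd hβ hfe₂ hfe₂)
    exact h2.congr (Eventually.of_forall fun v => by ring)
  have hd12 : Integrable fun v =>
      (collisionFrequency β v * (R v).re ^ 2 - (R v).re * carlemanGain β (fun w => (R w).re) v) * maxwellianBeta β v +
        (collisionFrequency β v * (R v).im ^ 2 - (R v).im * carlemanGain β (fun w => (R w).im) v) * maxwellianBeta β v :=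
    hd₁.add hd₂
  have hZ₁ : Integrable fun v => ((R v).re - m₁) ^ 2 * (collisionFrequency β v * maxwellianBeta β v) :=
    (hfe₁.sub_const hβ m₁).integrable.congr (Eventually.of_forall fun v => by ring)
  have hZ₂ : Integrable fun v => ((R v).im - m₂) ^ 2 * (collisionFrequency β v * maxwellianBeta β v) :=
    (hfe₂.sub_const hβ m₂).integrable.congr (Eventually.of_forall fun v => by ring)
  have hZint : Integrable fun v => (((R v).re - m₁) ^ 2 + ((R v).im - m₂) ^ 2) * (collisionFrequency β v * maxwellianBeta β v) := by
    have h1 : Integrable fun v => ((R v).re - m₁) ^ 2 * (collisionFrequency β v * maxwellianBeta β v) +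
        ((R v).im - m₂) ^ 2 * (collisionFrequency β v * maxwellianBeta β v) := hZ₁.add hZ₂
    exact h1.congr (Eventually.of_forall fun v => by ring)
  have hN₀int : Integrable fun v => (fourierPhase k v * correctorPhase k b v - lam) ^ 2 / collisionFrequency β v * maxwellianBeta β v :=
    integrable_source₀_sq_div_mul_maxwellianBeta hd hβ hb k
  have hS₀int : Integrable fun v => (fourierPhase k v * correctorPhase k b v - lam) * maxwellianBeta β v :=
    integrable_source₀_mul_maxwellianBeta hd hβ hb k
  have hyint : Integrable fun v => ‖R v‖ ^ 2 * maxwellianBeta β v := by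
    have h1 := integrable_sq_mul_maxwellianBeta_of_finiteEnergy hd hβ hfe₁
    have h2 := integrable_sq_mul_maxwellianBeta_of_finiteEnergy hd hβ hfe₂
    have h3 : Integrable fun v => (R v).re ^ 2 * maxwellianBeta β v + (R v).im ^ 2 * maxwellianBeta β v := h1.add h2
    exact h3.congr (Eventually.of_forall fun v => by simp only [Complex.sq_norm, Complex.normSq_apply]; ring)
  have hPint : Integrable fun v => correctorPhase k b v ^ 2 * maxwellianBeta β v :=
    integrable_sq_mul_maxwellianBeta_of_finiteEnergy hd hβ hp
  -- the five source pieces with their constants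
  have hI₁ : Integrable fun v => (2 * α * c₀) * ((((R v).re - m₁) ^ 2 + ((R v).im - m₂) ^ 2) *
      (collisionFrequency β v * maxwellianBeta β v)) := hZint.const_mul _
  have hI₂ : Integrable fun v => ‖G‖ ^ 2 / (2 * α * c₀) *
      ((fourierPhase k v * correctorPhase k b v - lam) ^ 2 / collisionFrequency β v * maxwellianBeta β v) := hN₀int.const_mul _
  have hI₃ : Integrable fun v => (2 * (G * (starRingEnd ℂ) m).re) * ((fourierPhase k v * correctorPhase k b v - lam) *
      maxwellianBeta β v) := hS₀int.const_mul _
  have hI₄ : Integrable fun v => ‖G‖ * α⁻¹ * (‖R v‖ ^ 2 * maxwellianBeta β v) := hyint.const_mul _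
  have hI₅ : Integrable fun v => ‖G‖ * α⁻¹ * lam ^ 2 * (correctorPhase k b v ^ 2 * maxwellianBeta β v) := hPint.const_mul _
  have hI₁₂ : Integrable fun v => (2 * α * c₀) * ((((R v).re - m₁) ^ 2 + ((R v).im - m₂) ^ 2) *
      (collisionFrequency β v * maxwellianBeta β v)) + ‖G‖ ^ 2 / (2 * α * c₀) *
      ((fourierPhase k v * correctorPhase k b v - lam) ^ 2 / collisionFrequency β v * maxwellianBeta β v) := hI₁.add hI₂
  have hI₁₂₃ : Integrable fun v => (2 * α * c₀) * ((((R v).re - m₁) ^ 2 + ((R v).im - m₂) ^ 2) *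
      (collisionFrequency β v * maxwellianBeta β v)) + ‖G‖ ^ 2 / (2 * α * c₀) *
      ((fourierPhase k v * correctorPhase k b v - lam) ^ 2 / collisionFrequency β v * maxwellianBeta β v) +
      (2 * (G * (starRingEnd ℂ) m).re) * ((fourierPhase k v * correctorPhase k b v - lam) * maxwellianBeta β v) := hI₁₂.add hI₃
  have hI₁₂₃₄ : Integrable fun v => (2 * α * c₀) * ((((R v).re - m₁) ^ 2 + ((R v).im - m₂) ^ 2) *
      (collisionFrequency β v * maxwellianBeta β v)) + ‖G‖ ^ 2 / (2 * α * c₀) *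
      ((fourierPhase k v * correctorPhase k b v - lam) ^ 2 / collisionFrequency β v * maxwellianBeta β v) +
      (2 * (G * (starRingEnd ℂ) m).re) * ((fourierPhase k v * correctorPhase k b v - lam) * maxwellianBeta β v) +
      ‖G‖ * α⁻¹ * (‖R v‖ ^ 2 * maxwellianBeta β v) := hI₁₂₃.add hI₄
  have hIall : Integrable fun v => (2 * α * c₀) * ((((R v).re - m₁) ^ 2 + ((R v).im - m₂) ^ 2) *
      (collisionFrequency β v * maxwellianBeta β v)) + ‖G‖ ^ 2 / (2 * α * c₀) *
      ((fourierPhase k v * correctorPhase k b v - lam) ^ 2 / collisionFrequency β v * maxwellianBeta β v) +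
      (2 * (G * (starRingEnd ℂ) m).re) * ((fourierPhase k v * correctorPhase k b v - lam) * maxwellianBeta β v) +
      ‖G‖ * α⁻¹ * (‖R v‖ ^ 2 * maxwellianBeta β v) +
      ‖G‖ * α⁻¹ * lam ^ 2 * (correctorPhase k b v ^ 2 * maxwellianBeta β v) := hI₁₂₃₄.add hI₅
  have hDint : Integrable fun v => (-2 * α) *
      ((collisionFrequency β v * (R v).re ^ 2 - (R v).re * carlemanGain β (fun w => (R w).re) v) * maxwellianBeta β v +
        (collisionFrequency β v * (R v).im ^ 2 - (R v).im * carlemanGain β (fun w => (R w).im) v) * maxwellianBeta β v) :=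
    hd12.const_mul _
  -- Step 3: integrate and compute
  have hDI : Integrable fun v => (-2 * α) *
      ((collisionFrequency β v * (R v).re ^ 2 - (R v).re * carlemanGain β (fun w => (R w).re) v) * maxwellianBeta β v +
        (collisionFrequency β v * (R v).im ^ 2 - (R v).im * carlemanGain β (fun w => (R w).im) v) * maxwellianBeta β v) +
      ((2 * α * c₀) * ((((R v).re - m₁) ^ 2 + ((R v).im - m₂) ^ 2) * (collisionFrequency β v * maxwellianBeta β v)) +
        ‖G‖ ^ 2 / (2 * α * c₀) *
          ((fourierPhase k v * correctorPhase k b v - lam) ^ 2 / collisionFrequency β v * maxwellianBeta β v) +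
        (2 * (G * (starRingEnd ℂ) m).re) * ((fourierPhase k v * correctorPhase k b v - lam) * maxwellianBeta β v) +
        ‖G‖ * α⁻¹ * (‖R v‖ ^ 2 * maxwellianBeta β v) +
        ‖G‖ * α⁻¹ * lam ^ 2 * (correctorPhase k b v ^ 2 * maxwellianBeta β v)) := hDint.add hIall
  have hmono := integral_mono_ae hLint hDI hpt
  have heq : (∫ v, (-2 * α) *
      ((collisionFrequency β v * (R v).re ^ 2 - (R v).re * carlemanGain β (fun w => (R w).re) v) * maxwellianBeta β v +
        (collisionFrequency β v * (R v).im ^ 2 - (R v).im * carlemanGain β (fun w => (R w).im) v) * maxwellianBeta β v) +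
      ((2 * α * c₀) * ((((R v).re - m₁) ^ 2 + ((R v).im - m₂) ^ 2) * (collisionFrequency β v * maxwellianBeta β v)) +
        ‖G‖ ^ 2 / (2 * α * c₀) *
          ((fourierPhase k v * correctorPhase k b v - lam) ^ 2 / collisionFrequency β v * maxwellianBeta β v) +
        (2 * (G * (starRingEnd ℂ) m).re) * ((fourierPhase k v * correctorPhase k b v - lam) * maxwellianBeta β v) +
        ‖G‖ * α⁻¹ * (‖R v‖ ^ 2 * maxwellianBeta β v) +
        ‖G‖ * α⁻¹ * lam ^ 2 * (correctorPhase k b v ^ 2 * maxwellianBeta β v))) =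
      (-2 * α) * (dirichletForm β (fun v => (R v).re) (fun v => (R v).re) +
          dirichletForm β (fun v => (R v).im) (fun v => (R v).im)) +
        ((2 * α * c₀) * ((∫ v, ((R v).re - m₁) ^ 2 * (collisionFrequency β v * maxwellianBeta β v)) +
            ∫ v, ((R v).im - m₂) ^ 2 * (collisionFrequency β v * maxwellianBeta β v)) +
          ‖G‖ ^ 2 / (2 * α * c₀) * sourceNormSq β b k + 2 * (G * (starRingEnd ℂ) m).re * 0 +
          ‖G‖ * α⁻¹ * fibreEnergy β α b ρ₀ k t + ‖G‖ * α⁻¹ * lam ^ 2 * correctorPhaseNormSq β b k) := by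
    rw [integral_add hDint hIall, integral_add hI₁₂₃₄ hI₅, integral_add hI₁₂₃ hI₄, integral_add hI₁₂ hI₃, integral_add hI₁ hI₂]
    simp only [integral_const_mul]
    rw [integral_add hd₁ hd₂, integral_sub_mul_carlemanGain_eq_dirichletForm hd hβ hfe₁,
      integral_sub_mul_carlemanGain_eq_dirichletForm hd hβ hfe₂, integral_source₀_mul_maxwellianBeta hd hβ hb k]
    have hZsplit : ∫ v, (((R v).re - m₁) ^ 2 + ((R v).im - m₂) ^ 2) * (collisionFrequency β v * maxwellianBeta β v) =
        (∫ v, ((R v).re - m₁) ^ 2 * (collisionFrequency β v * maxwellianBeta β v)) +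
          ∫ v, ((R v).im - m₂) ^ 2 * (collisionFrequency β v * maxwellianBeta β v) := by
      rw [← integral_add hZ₁ hZ₂]
      exact integral_congr_ae (Eventually.of_forall fun v => by ring)
    rw [hZsplit]
    rfl
  rw [heq] at hmono
  refine hmono.trans ?_
  -- Step 4: the gap and the bookkeeping
  · have hB₁ := hgap _ hfe₁
    have hB₂ := hgap _ hfe₂
    rw [← hm₁] at hB₁
    rw [← hm₂] at hB₂
    set Z₁ := ∫ v, ((R v).re - m₁) ^ 2 * (collisionFrequency β v * maxwellianBeta β v) with hZ₁def
    set Z₂ := ∫ v, ((R v).im - m₂) ^ 2 * (collisionFrequency β v * maxwellianBeta β v) with hZ₂def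
    set B₁ := dirichletForm β (fun v => (R v).re) (fun v => (R v).re) with hB₁def
    set B₂ := dirichletForm β (fun v => (R v).im) (fun v => (R v).im) with hB₂def
    have hN₀ : 0 ≤ sourceNormSq β b k := sourceNormSq_nonneg hβ b k
    have hP₀ : 0 ≤ correctorPhaseNormSq β b k := correctorPhaseNormSq_nonneg hβ b k
    have hy₀ : 0 ≤ fibreEnergy β α b ρ₀ k t := fibreEnergy_nonneg hβ b ρ₀ k t
    have hG0 : 0 ≤ ‖G‖ := norm_nonneg _
    have hg0 : 0 ≤ g := norm_nonneg _
    -- dissipation beats the Young term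
    have h1 : (-2 * α) * (B₁ + B₂) + (2 * α * c₀) * (Z₁ + Z₂) ≤ 0 := by nlinarith
    -- the three source contributions
    have h2 : ‖G‖ ^ 2 / (2 * α * c₀) * sourceNormSq β b k ≤ g ^ 2 * sourceNormSq β b k / (2 * c₀ * α ^ 3) := by
      have hsq : ‖G‖ ^ 2 ≤ (g * α⁻¹) ^ 2 := pow_le_pow_left₀ hG0 hGle 2
      have : ‖G‖ ^ 2 / (2 * α * c₀) ≤ (g * α⁻¹) ^ 2 / (2 * α * c₀) := div_le_div_of_nonneg_right hsq (by positivity)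
      calc ‖G‖ ^ 2 / (2 * α * c₀) * sourceNormSq β b k ≤ (g * α⁻¹) ^ 2 / (2 * α * c₀) * sourceNormSq β b k :=
            mul_le_mul_of_nonneg_right this hN₀
        _ = g ^ 2 * sourceNormSq β b k / (2 * c₀ * α ^ 3) := by field_simp
    have h3 : ‖G‖ * α⁻¹ * fibreEnergy β α b ρ₀ k t ≤ g / α ^ 2 * fibreEnergy β α b ρ₀ k t := by
      have : ‖G‖ * α⁻¹ ≤ g * α⁻¹ * α⁻¹ := mul_le_mul_of_nonneg_right hGle (inv_pos.2 hα0).le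
      calc ‖G‖ * α⁻¹ * fibreEnergy β α b ρ₀ k t ≤ g * α⁻¹ * α⁻¹ * fibreEnergy β α b ρ₀ k t :=
            mul_le_mul_of_nonneg_right this hy₀
        _ = g / α ^ 2 * fibreEnergy β α b ρ₀ k t := by field_simp
    have h4 : ‖G‖ * α⁻¹ * lam ^ 2 * correctorPhaseNormSq β b k ≤ g * lam ^ 2 * correctorPhaseNormSq β b k / α ^ 2 := by
      have : ‖G‖ * α⁻¹ ≤ g * α⁻¹ * α⁻¹ := mul_le_mul_of_nonneg_right hGle (inv_pos.2 hα0).le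
      calc ‖G‖ * α⁻¹ * lam ^ 2 * correctorPhaseNormSq β b k
          = ‖G‖ * α⁻¹ * (lam ^ 2 * correctorPhaseNormSq β b k) := by ring
        _ ≤ g * α⁻¹ * α⁻¹ * (lam ^ 2 * correctorPhaseNormSq β b k) := mul_le_mul_of_nonneg_right this (by positivity)
        _ = g * lam ^ 2 * correctorPhaseNormSq β b k / α ^ 2 := by field_simp
    linarith

end Remainder

/-! ## Grönwall and the estimates -/

section Gronwall

open Literature.Analysis.FluidPDE Literature.Analysis.FunctionSpaces

variable {b : EuclideanSpace ℝ d → EuclideanSpace ℝ d} {ρ₀ : UnitAddTorus d → ℝ} {ϱ : ℝ} {k : d → ℤ}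

/-- **The energy at time `0`**: `y(0) = |ρ̂⁰(k)|² α⁻² ∫ p² M_β` (`R(0) = -i α⁻¹ ρ̂⁰(k) p`). [folklore] -/
theorem fibreEnergy_zero (k : d → ℤ) :
    fibreEnergy β α b ρ₀ k 0 = ‖datumCoeff ρ₀ k‖ ^ 2 * α⁻¹ ^ 2 * correctorPhaseNormSq β b k := by
  rw [fibreEnergy, correctorPhaseNormSq, ← integral_const_mul]
  refine integral_congr_ae (Eventually.of_forall fun v => ?_)
  have hR : fibreRemainder β α b ρ₀ k 0 v = -(datumCoeff ρ₀ k * (I * ((α⁻¹ * correctorPhase k b v : ℝ) : ℂ))) := by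
    rw [fibreRemainder, seriesFibre, kineticFibre_linearBoltzmannSeries_zero, ← datumCoeff, fibreExpansion]
    simp only [mul_zero, neg_zero, Real.exp_zero, Complex.ofReal_one, mul_one]
    ring
  simp only
  rw [hR, norm_neg, norm_mul, norm_mul, Complex.norm_I, one_mul, Complex.norm_real, Real.norm_eq_abs, abs_mul, mul_pow, mul_pow,
    sq_abs, sq_abs]
  ring

/-- **Grönwall bound on the energy** (`α ≥ 1`, `t ≥ 0`):
`y(t) ≤ (y(0) + A t) e^{B t}` with `y(0) = |ρ̂⁰(k)|² P²/α²`, `A = |ρ̂⁰(k)|² N₀²/(2c₀α³) + |ρ̂⁰(k)| λ² P²/α²`,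
`B = |ρ̂⁰(k)|/α²`. [cite: BodineauGallagherSaintRaymondInvent2016, §6.1.3] -/
theorem fibreEnergy_le (h : LinearBoltzmannData (Torus.geometry d) β α (fun x _ => ρ₀ x) ϱ)
    (hd : 2 ≤ Fintype.card d) (hb : IsDiffusionCorrector β b) (hα : 1 ≤ α) (k : d → ℤ) {c₀ : ℝ} (hc₀ : 0 < c₀)
    (hgap : ∀ g : 𝔼 → ℝ, FiniteEnergy β g →
      c₀ * ∫ v, (g v - energyMean β g) ^ 2 * (collisionFrequency β v * maxwellianBeta β v) ≤ dirichletForm β g g)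
    {t : ℝ} (ht : 0 ≤ t) :
    fibreEnergy β α b ρ₀ k t ≤
      (‖datumCoeff ρ₀ k‖ ^ 2 * α⁻¹ ^ 2 * correctorPhaseNormSq β b k +
        (‖datumCoeff ρ₀ k‖ ^ 2 * sourceNormSq β b k / (2 * c₀ * α ^ 3) +
          ‖datumCoeff ρ₀ k‖ * heatRate β b k ^ 2 * correctorPhaseNormSq β b k / α ^ 2) * t) *
        Real.exp (‖datumCoeff ρ₀ k‖ / α ^ 2 * t) := by
  have hβ := h.beta_pos
  have hα0 : 0 < α := by linarith
  set A := ‖datumCoeff ρ₀ k‖ ^ 2 * sourceNormSq β b k / (2 * c₀ * α ^ 3) +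
    ‖datumCoeff ρ₀ k‖ * heatRate β b k ^ 2 * correctorPhaseNormSq β b k / α ^ 2 with hA
  set B := ‖datumCoeff ρ₀ k‖ / α ^ 2 with hB
  have hA0 : 0 ≤ A := by
    have := sourceNormSq_nonneg hβ b k; have := correctorPhaseNormSq_nonneg hβ b k
    positivity
  have hB0 : 0 ≤ B := by positivity
  set y := fibreEnergy β α b ρ₀ k with hy
  have hy0 : y 0 = ‖datumCoeff ρ₀ k‖ ^ 2 * α⁻¹ ^ 2 * correctorPhaseNormSq β b k := fibreEnergy_zero k
  rw [← hy0]
  have hcont : Continuous y := continuous_fibreEnergy h hd hb hα k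
  -- Grönwall on `[ε, t]` for every `0 < ε ≤ t`
  have hG : ∀ ε, 0 < ε → ε ≤ t → y t ≤ gronwallBound (y ε) B A (t - ε) := by
    intro ε hε hεt
    have := le_gronwallBound_of_liminf_deriv_right_le (f := y)
      (f' := fun x => ∫ v, 2 * ⟪fibreRemainder β α b ρ₀ k x v, fibreRemainderDeriv β α b ρ₀ k x v⟫_ℝ * maxwellianBeta β v)
      (δ := y ε) (K := B) (ε := A) (a := ε) (b := t) hcont.continuousOn (fun x hx r hr => ?_) le_rfl (fun x hx => ?_) t
      ⟨hεt, le_rfl⟩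
    · exact this
    · have hx0 : 0 < x := hε.trans_le hx.1
      exact ((hasDerivAt_fibreEnergy h hd hb hα k hx0).hasDerivWithinAt (s := Ici x)).liminf_right_slope_le hr
    · have hx0 : 0 < x := hε.trans_le hx.1
      have := fibreEnergy_deriv_le h hd hb hα k hc₀ hgap hx0
      rw [← hA, ← hB] at this
      linarith
  -- let `ε → 0⁺`
  rcases eq_or_lt_of_le ht with ht0 | htpos
  · rw [← ht0]; simp
  have hlim : Tendsto (fun ε => gronwallBound (y ε) B A (t - ε)) (𝓝[>] 0) (𝓝 (gronwallBound (y 0) B A (t - 0))) := by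
    have hc : Continuous fun ε => gronwallBound (y ε) B A (t - ε) := by
      by_cases hB0' : B = 0
      · simp only [hB0', gronwallBound_K0]; fun_prop
      · simp only [gronwallBound_of_K_ne_0 hB0']; fun_prop
    exact (hc.tendsto 0).mono_left nhdsWithin_le_nhds
  rw [sub_zero] at hlim
  have hev : ∀ᶠ ε in 𝓝[>] (0 : ℝ), y t ≤ gronwallBound (y ε) B A (t - ε) := by
    have h1 : ∀ᶠ ε in 𝓝[>] (0 : ℝ), ε ∈ Ioo 0 t := Ioo_mem_nhdsGT htpos
    filter_upwards [h1] with ε hε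
    exact hG ε hε.1 hε.2.le
  exact (ge_of_tendsto hlim hev).trans (IsModePair.gronwallBound_le_mul_exp hB0 hA0)

/-- `‖R(t)‖² M_β` is integrable (`t ≥ 0`). [folklore] -/
theorem integrable_norm_sq_fibreRemainder_mul (h : LinearBoltzmannData (Torus.geometry d) β α (fun x _ => ρ₀ x) ϱ)
    (hd : 2 ≤ Fintype.card d) (hb : IsDiffusionCorrector β b) (hα : 1 ≤ α) (k : d → ℤ) {t : ℝ} (ht : 0 ≤ t) :
    Integrable fun v => ‖fibreRemainder β α b ρ₀ k t v‖ ^ 2 * maxwellianBeta β v := by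
  have hβ := h.beta_pos
  obtain ⟨hfe₁, hfe₂⟩ := finiteEnergy_reIm_fibreRemainder h hd hb hα k ht
  have h1 := integrable_sq_mul_maxwellianBeta_of_finiteEnergy hd hβ hfe₁
  have h2 := integrable_sq_mul_maxwellianBeta_of_finiteEnergy hd hβ hfe₂
  have h3 : Integrable fun v => (fibreRemainder β α b ρ₀ k t v).re ^ 2 * maxwellianBeta β v +
      (fibreRemainder β α b ρ₀ k t v).im ^ 2 * maxwellianBeta β v := h1.add h2
  exact h3.congr (Eventually.of_forall fun v => by simp only [Complex.sq_norm, Complex.normSq_apply]; ring)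

/-- If the energy vanishes then the remainder vanishes a.e. [folklore] -/
theorem fibreRemainder_ae_eq_zero (h : LinearBoltzmannData (Torus.geometry d) β α (fun x _ => ρ₀ x) ϱ)
    (hd : 2 ≤ Fintype.card d) (hb : IsDiffusionCorrector β b) (hα : 1 ≤ α) (k : d → ℤ) {t : ℝ} (ht : 0 ≤ t)
    (hy : fibreEnergy β α b ρ₀ k t = 0) : ∀ᵐ v : 𝔼, fibreRemainder β α b ρ₀ k t v = 0 := by
  have hβ := h.beta_pos
  have h1 := (integral_eq_zero_iff_of_nonneg (fun v => mul_nonneg (sq_nonneg _) (maxwellianBeta_pos hβ v).le)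
    (integrable_norm_sq_fibreRemainder_mul h hd hb hα k ht)).1 hy
  filter_upwards [h1] with v hv
  simp only [Pi.zero_apply, mul_eq_zero, (maxwellianBeta_pos hβ v).ne', or_false] at hv
  exact norm_eq_zero.1 (pow_eq_zero_iff two_ne_zero |>.1 hv)

/-- `P² = 0` for `k = 0`. [folklore] -/
theorem correctorPhaseNormSq_zero (β : ℝ) (b : 𝔼 → 𝔼) : correctorPhaseNormSq β b (0 : d → ℤ) = 0 := by
  simp [correctorPhaseNormSq, correctorPhase_zero]

/-- `N₀² = 0` for `k = 0`. [folklore] -/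
theorem sourceNormSq_zero (β : ℝ) (b : 𝔼 → 𝔼) : sourceNormSq β b (0 : d → ℤ) = 0 := by
  simp [sourceNormSq, correctorPhase_zero, heatRate_zero, fourierPhase_zero]

/-- The expansion of the zero mode is the constant `ρ̂⁰(0)`. [folklore] -/
theorem fibreExpansion_zero_mode (β α : ℝ) (b : 𝔼 → 𝔼) (g₀ : ℂ) (t : ℝ) (v : 𝔼) :
    fibreExpansion β α b (0 : d → ℤ) g₀ t v = g₀ := by
  simp [fibreExpansion, heatRate_zero, correctorPhase_zero]

/-- **Fibres off the spectrum of the datum vanish identically**: if `ρ̂⁰(k) = 0` then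
`ψ_k(t, v) = 0` for all `t ≥ 0` and all `v` (energy dissipation `y' ≤ 0`, `y(0) = 0`, and continuity
in `v`). [folklore] -/
theorem seriesFibre_eq_zero_of_datumCoeff_eq_zero (h : LinearBoltzmannData (Torus.geometry d) β α (fun x _ => ρ₀ x) ϱ)
    (hd : 2 ≤ Fintype.card d) (hα : 1 ≤ α) {k : d → ℤ} (hk : datumCoeff ρ₀ k = 0) {t : ℝ} (ht : 0 ≤ t) (v : 𝔼) :
    seriesFibre β α ρ₀ k t v = 0 := by
  have hβ := h.beta_pos
  obtain ⟨⟨b, hb⟩, -⟩ := bgsr_exists_diffusionCorrector_holds hd hβ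
  obtain ⟨c₀, hc₀, hgap⟩ := exists_spectralGap hd hβ
  have hle := fibreEnergy_le h hd hb hα k hc₀ hgap ht
  simp only [hk, norm_zero] at hle
  norm_num at hle
  have hy : fibreEnergy β α b ρ₀ k t = 0 := le_antisymm hle (fibreEnergy_nonneg hβ b ρ₀ k t)
  have hae := fibreRemainder_ae_eq_zero h hd hb hα k ht hy
  have hΨ : ∀ w, fibreExpansion β α b k (datumCoeff ρ₀ k) t w = 0 := fun w => by simp [fibreExpansion, hk]
  have hae' : (fun w => seriesFibre β α ρ₀ k t w) =ᵐ[volume] fun _ => (0 : ℂ) := by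
    filter_upwards [hae] with w hw
    rw [fibreRemainder, hΨ, zero_sub, neg_eq_zero] at hw
    exact hw
  have hcont : Continuous fun w => seriesFibre β α ρ₀ k t w :=
    (continuous_seriesFibre h k).comp (continuous_const.prodMk continuous_id)
  exact congrFun ((hcont.ae_eq_iff_eq volume continuous_const).1 hae') v

/-- **The zero mode is conserved**: `ψ_0(t, v) = ρ̂⁰(0) = ∫ ρ⁰` for all `t ≥ 0`, `v` (mass conservation
of the fibred equation, in the energy form). [folklore] -/
theorem seriesFibre_zero_mode (h : LinearBoltzmannData (Torus.geometry d) β α (fun x _ => ρ₀ x) ϱ)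
    (hd : 2 ≤ Fintype.card d) (hα : 1 ≤ α) {t : ℝ} (ht : 0 ≤ t) (v : 𝔼) :
    seriesFibre β α ρ₀ 0 t v = datumCoeff ρ₀ 0 := by
  have hβ := h.beta_pos
  obtain ⟨⟨b, hb⟩, -⟩ := bgsr_exists_diffusionCorrector_holds hd hβ
  obtain ⟨c₀, hc₀, hgap⟩ := exists_spectralGap hd hβ
  have hle := fibreEnergy_le h hd hb hα 0 hc₀ hgap ht
  simp only [correctorPhaseNormSq_zero, sourceNormSq_zero, heatRate_zero] at hle
  norm_num at hle
  have hy : fibreEnergy β α b ρ₀ 0 t = 0 := le_antisymm hle (fibreEnergy_nonneg hβ b ρ₀ 0 t)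
  have hae := fibreRemainder_ae_eq_zero h hd hb hα 0 ht hy
  have hae' : (fun w => seriesFibre β α ρ₀ 0 t w) =ᵐ[volume] fun _ => datumCoeff ρ₀ 0 := by
    filter_upwards [hae] with w hw
    rw [fibreRemainder, fibreExpansion_zero_mode, sub_eq_zero] at hw
    exact hw.symm
  have hcont : Continuous fun w => seriesFibre β α ρ₀ 0 t w :=
    (continuous_seriesFibre h 0).comp (continuous_const.prodMk continuous_id)
  exact congrFun ((hcont.ae_eq_iff_eq volume continuous_const).1 hae') v

/-- **The energy estimate for the fibres** (BGSR (6.3) in `L²(M_β)`, mode by mode, with rate):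
for `d ≥ 2`, `β > 0`, a corrector `b`, a datum `ρ⁰` and `T ≥ 0` there is `C ≥ 0` such that for every
`α ≥ 1` and every `t ∈ [0, αT]`,
`∫ |ψ_k(t, v) - ρ̂⁰(k) e^{-λt/α}|² M_β(v) dv ≤ C / α`, `λ = 4π² κ_β |k|²`
(`ψ_k` the `k`-th Fourier coefficient of the solution of (1.3) with rate `α`).
[cite: BodineauGallagherSaintRaymondInvent2016, (6.3) and §6.1.3] -/
theorem kineticFibre_energy_estimate (hd : 2 ≤ Fintype.card d) (hβ : 0 < β) (hb : IsDiffusionCorrector β b)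
    (ρ₀ : 𝕋 → ℝ) (k : d → ℤ) {T : ℝ} (hT : 0 ≤ T) :
    ∃ C : ℝ, 0 ≤ C ∧ ∀ ⦃α ϱ : ℝ⦄, 1 ≤ α → LinearBoltzmannData (Torus.geometry d) β α (fun x _ => ρ₀ x) ϱ →
      ∀ t ∈ Icc 0 (α * T),
        ∫ v, ‖seriesFibre β α ρ₀ k t v - datumCoeff ρ₀ k * (Real.exp (-(heatRate β b k / α * t)) : ℂ)‖ ^ 2 *
          maxwellianBeta β v ≤ C / α := by
  obtain ⟨c₀, hc₀, hgap⟩ := exists_spectralGap hd hβ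
  set g := ‖datumCoeff ρ₀ k‖ with hg
  set P := correctorPhaseNormSq β b k with hP
  set N := sourceNormSq β b k with hN
  set lam := heatRate β b k with hlam
  have hg0 : 0 ≤ g := norm_nonneg _
  have hP0 : 0 ≤ P := correctorPhaseNormSq_nonneg hβ b k
  have hN0 : 0 ≤ N := sourceNormSq_nonneg hβ b k
  have hlam0 : 0 ≤ lam := heatRate_nonneg hd hβ hb k
  set C₁ := (g ^ 2 * P + (g ^ 2 * N / (2 * c₀) + g * lam ^ 2 * P) * T) * Real.exp (g * T) with hC₁
  have hC₁0 : 0 ≤ C₁ := by positivity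
  refine ⟨2 * C₁ + 2 * g ^ 2 * P, by positivity, fun α ϱ hα h t ht => ?_⟩
  have hα0 : 0 < α := by linarith
  have hαinv : α⁻¹ ≤ 1 := inv_le_one_of_one_le₀ hα
  have hαinv0 : 0 ≤ α⁻¹ := (inv_pos.2 hα0).le
  have ht0 : 0 ≤ t := ht.1
  have htT : t ≤ α * T := ht.2
  have hp := finiteEnergy_correctorPhase hβ hb k
  -- the Grönwall bound, simplified for `α ≥ 1`, `t ≤ αT`
  have hy : fibreEnergy β α b ρ₀ k t ≤ C₁ / α := by
    have h1 := fibreEnergy_le h hd hb hα k hc₀ hgap ht0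
    rw [← hg, ← hP, ← hN, ← hlam] at h1
    have h2 : g ^ 2 * α⁻¹ ^ 2 * P + (g ^ 2 * N / (2 * c₀ * α ^ 3) + g * lam ^ 2 * P / α ^ 2) * t ≤
        (g ^ 2 * P + (g ^ 2 * N / (2 * c₀) + g * lam ^ 2 * P) * T) / α := by
      have e1 : g ^ 2 * α⁻¹ ^ 2 * P ≤ g ^ 2 * P / α := by
        calc g ^ 2 * α⁻¹ ^ 2 * P = (g ^ 2 * P * α⁻¹) * α⁻¹ := by ring
          _ ≤ (g ^ 2 * P * α⁻¹) * 1 := by gcongr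
          _ = g ^ 2 * P / α := by ring
      have e2 : g ^ 2 * N / (2 * c₀ * α ^ 3) * t ≤ g ^ 2 * N / (2 * c₀) * T / α := by
        calc g ^ 2 * N / (2 * c₀ * α ^ 3) * t ≤ g ^ 2 * N / (2 * c₀ * α ^ 3) * (α * T) := by gcongr
          _ = (g ^ 2 * N / (2 * c₀) * T / α) * α⁻¹ := by field_simp
          _ ≤ (g ^ 2 * N / (2 * c₀) * T / α) * 1 := by gcongr
          _ = g ^ 2 * N / (2 * c₀) * T / α := by ring
      have e3 : g * lam ^ 2 * P / α ^ 2 * t ≤ g * lam ^ 2 * P * T / α := by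
        calc g * lam ^ 2 * P / α ^ 2 * t ≤ g * lam ^ 2 * P / α ^ 2 * (α * T) := by gcongr
          _ = g * lam ^ 2 * P * T / α := by field_simp
      have e4 : (g ^ 2 * P + (g ^ 2 * N / (2 * c₀) + g * lam ^ 2 * P) * T) / α =
          g ^ 2 * P / α + g ^ 2 * N / (2 * c₀) * T / α + g * lam ^ 2 * P * T / α := by ring
      rw [e4]
      nlinarith [e1, e2, e3]
    have h3 : Real.exp (g / α ^ 2 * t) ≤ Real.exp (g * T) := by
      rw [Real.exp_le_exp]
      calc g / α ^ 2 * t ≤ g / α ^ 2 * (α * T) := by gcongr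
        _ = g * T * (α⁻¹ * (α⁻¹ * α)) := by field_simp
        _ = g * T * α⁻¹ := by rw [inv_mul_cancel₀ hα0.ne', mul_one]
        _ ≤ g * T * 1 := by gcongr
        _ = g * T := mul_one _
    have h4 : 0 ≤ g ^ 2 * α⁻¹ ^ 2 * P + (g ^ 2 * N / (2 * c₀ * α ^ 3) + g * lam ^ 2 * P / α ^ 2) * t := by positivity
    calc fibreEnergy β α b ρ₀ k t ≤ _ := h1
      _ ≤ (g ^ 2 * P + (g ^ 2 * N / (2 * c₀) + g * lam ^ 2 * P) * T) / α * Real.exp (g * T) :=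
          mul_le_mul h2 h3 (Real.exp_nonneg _) (div_nonneg (by positivity) hα0.le)
      _ = C₁ / α := by rw [hC₁]; ring
  -- from `R` to `ψ - ρ̂⁰ e^{-λt/α}`
  have hpt : ∀ v, ‖seriesFibre β α ρ₀ k t v - datumCoeff ρ₀ k * (Real.exp (-(lam / α * t)) : ℂ)‖ ^ 2 * maxwellianBeta β v ≤
      2 * (‖fibreRemainder β α b ρ₀ k t v‖ ^ 2 * maxwellianBeta β v) + 2 * g ^ 2 * α⁻¹ ^ 2 * (correctorPhase k b v ^ 2 * maxwellianBeta β v) := by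
    intro v
    have hM := (maxwellianBeta_pos hβ v).le
    have hdec : seriesFibre β α ρ₀ k t v - datumCoeff ρ₀ k * (Real.exp (-(lam / α * t)) : ℂ) =
        (fibreExpansion β α b k (datumCoeff ρ₀ k) t v - datumCoeff ρ₀ k * (Real.exp (-(lam / α * t)) : ℂ)) -
          fibreRemainder β α b ρ₀ k t v := by
      rw [fibreRemainder]; ring
    have hΨ : fibreExpansion β α b k (datumCoeff ρ₀ k) t v - datumCoeff ρ₀ k * (Real.exp (-(lam / α * t)) : ℂ) =
        -(datumCoeff ρ₀ k * (Real.exp (-(lam / α * t)) : ℂ) * (I * ((α⁻¹ * correctorPhase k b v : ℝ) : ℂ))) := by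
      rw [fibreExpansion, hlam]; ring
    have he : Real.exp (-(lam / α * t)) ≤ 1 := exp_heatRate_le_one (div_nonneg hlam0 hα0.le) ht0
    have hΨn : ‖fibreExpansion β α b k (datumCoeff ρ₀ k) t v - datumCoeff ρ₀ k * (Real.exp (-(lam / α * t)) : ℂ)‖ ^ 2 ≤
        g ^ 2 * α⁻¹ ^ 2 * correctorPhase k b v ^ 2 := by
      rw [hΨ, norm_neg, norm_mul, norm_mul, norm_mul, Complex.norm_I, one_mul, Complex.norm_real, Complex.norm_real,
        Real.norm_of_nonneg (Real.exp_nonneg _), Real.norm_eq_abs, abs_mul, abs_of_nonneg hαinv0, ← hg]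
      have h1 : (g * Real.exp (-(lam / α * t)) * (α⁻¹ * |correctorPhase k b v|)) ^ 2 ≤
          (g * 1 * (α⁻¹ * |correctorPhase k b v|)) ^ 2 := by
        gcongr
      calc (g * Real.exp (-(lam / α * t)) * (α⁻¹ * |correctorPhase k b v|)) ^ 2
          ≤ (g * 1 * (α⁻¹ * |correctorPhase k b v|)) ^ 2 := h1
        _ = g ^ 2 * α⁻¹ ^ 2 * correctorPhase k b v ^ 2 := by rw [mul_one, mul_pow, mul_pow, sq_abs]; ring
    have hsq : ‖seriesFibre β α ρ₀ k t v - datumCoeff ρ₀ k * (Real.exp (-(lam / α * t)) : ℂ)‖ ^ 2 ≤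
        2 * ‖fibreRemainder β α b ρ₀ k t v‖ ^ 2 + 2 * (g ^ 2 * α⁻¹ ^ 2 * correctorPhase k b v ^ 2) := by
      rw [hdec]
      have h2 := norm_sub_le (fibreExpansion β α b k (datumCoeff ρ₀ k) t v - datumCoeff ρ₀ k * (Real.exp (-(lam / α * t)) : ℂ))
        (fibreRemainder β α b ρ₀ k t v)
      nlinarith [h2, norm_nonneg (fibreExpansion β α b k (datumCoeff ρ₀ k) t v - datumCoeff ρ₀ k * (Real.exp (-(lam / α * t)) : ℂ) -
        fibreRemainder β α b ρ₀ k t v), norm_nonneg (fibreRemainder β α b ρ₀ k t v),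
        sq_nonneg (‖fibreExpansion β α b k (datumCoeff ρ₀ k) t v - datumCoeff ρ₀ k * (Real.exp (-(lam / α * t)) : ℂ)‖ -
          ‖fibreRemainder β α b ρ₀ k t v‖)]
    calc _ ≤ (2 * ‖fibreRemainder β α b ρ₀ k t v‖ ^ 2 + 2 * (g ^ 2 * α⁻¹ ^ 2 * correctorPhase k b v ^ 2)) * maxwellianBeta β v :=
          mul_le_mul_of_nonneg_right hsq hM
      _ = _ := by ring
  have hint_l : Integrable fun v => ‖seriesFibre β α ρ₀ k t v - datumCoeff ρ₀ k * (Real.exp (-(lam / α * t)) : ℂ)‖ ^ 2 *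
      maxwellianBeta β v := by
    refine ((KineticTheory.integrable_maxwellianBeta hβ).const_mul ((ϱ + g) ^ 2)).mono' ?_ (Eventually.of_forall fun v => ?_)
    · exact ((((continuous_seriesFibre h k).measurable.comp (measurable_const.prodMk measurable_id)).sub measurable_const).norm.pow_const 2
        |>.mul (KineticTheory.measurable_maxwellianBeta β)).aestronglyMeasurable
    · have hM := (maxwellianBeta_pos hβ v).le
      rw [Real.norm_of_nonneg (mul_nonneg (sq_nonneg _) hM)]
      refine mul_le_mul_of_nonneg_right ?_ hM
      have h1 : ‖seriesFibre β α ρ₀ k t v - datumCoeff ρ₀ k * (Real.exp (-(lam / α * t)) : ℂ)‖ ≤ ϱ + g := by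
        refine (norm_sub_le _ _).trans (add_le_add (norm_seriesFibre_le h k t v) ?_)
        rw [norm_mul, Complex.norm_real, Real.norm_of_nonneg (Real.exp_nonneg _), ← hg]
        calc g * Real.exp (-(lam / α * t)) ≤ g * 1 := by gcongr; exact exp_heatRate_le_one (div_nonneg hlam0 hα0.le) ht0
          _ = g := mul_one _
      exact pow_le_pow_left₀ (norm_nonneg _) h1 2
  have hint_r : Integrable fun v => 2 * (‖fibreRemainder β α b ρ₀ k t v‖ ^ 2 * maxwellianBeta β v) +
      2 * g ^ 2 * α⁻¹ ^ 2 * (correctorPhase k b v ^ 2 * maxwellianBeta β v) :=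
    ((integrable_norm_sq_fibreRemainder_mul h hd hb hα k ht0).const_mul 2).add
      ((integrable_sq_mul_maxwellianBeta_of_finiteEnergy hd hβ hp).const_mul _)
  calc ∫ v, ‖seriesFibre β α ρ₀ k t v - datumCoeff ρ₀ k * (Real.exp (-(lam / α * t)) : ℂ)‖ ^ 2 * maxwellianBeta β v
      ≤ ∫ v, 2 * (‖fibreRemainder β α b ρ₀ k t v‖ ^ 2 * maxwellianBeta β v) +
          2 * g ^ 2 * α⁻¹ ^ 2 * (correctorPhase k b v ^ 2 * maxwellianBeta β v) := integral_mono hint_l hint_r hpt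
    _ = 2 * fibreEnergy β α b ρ₀ k t + 2 * g ^ 2 * α⁻¹ ^ 2 * P := by
        rw [integral_add ((integrable_norm_sq_fibreRemainder_mul h hd hb hα k ht0).const_mul 2)
          ((integrable_sq_mul_maxwellianBeta_of_finiteEnergy hd hβ hp).const_mul _), integral_const_mul, integral_const_mul]
        rfl
    _ ≤ 2 * (C₁ / α) + 2 * g ^ 2 * α⁻¹ * P := by
        have e : α⁻¹ ^ 2 ≤ α⁻¹ := by
          calc α⁻¹ ^ 2 = α⁻¹ * α⁻¹ := sq _
            _ ≤ α⁻¹ * 1 := by gcongr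
            _ = α⁻¹ := mul_one _
        have e' := mul_le_mul_of_nonneg_left e (by positivity : 0 ≤ 2 * g ^ 2 * P)
        nlinarith [hy, e']
    _ = (2 * C₁ + 2 * g ^ 2 * P) / α := by field_simp

end Gronwall

end Literature.MathematicalPhysics.KineticTheory
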